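import Mathlib
import Literature.AlgebraicGeometry.Resolution.VeryWellPreparation
import Literature.AlgebraicGeometry.Cutkosky2009.Lemma1016
import HarnessLib

/-!
# Cutkosky 2009, Theorem 10.17 (the characteristic-`p` heart): after a translation by a unit and a well preparation, `δ` drops below `β`

Topic: `Literature/AlgebraicGeometry/Resolution`. S. D. Cutkosky, *Resolution of singularities for
3-folds in positive characteristic*, Amer. J. Math. **131** (2009) 59–127, author version
`paper:doi-10-1353-ajm-0-0036`, p. 34 l. 35 – p. 36 l. 52, read on the page. "The following theorem is
the most delicate part of the proof, where we really see the difference between characteristic 0 and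
characteristic `p`. **Theorem 10.17.** Suppose that assumptions are as in Definition 10.10, `(x, y, z)`
and `(x₁, y₁, z₁)` are related by a Tr1 transformation with `η ≠ 0` and `(I; x, y, z)` is very well
prepared. Suppose that `ν_{T₁}(I₁) = r`, `τ(I₁) = 1` and `β_{xyz}(I) > 0`. Then there exist good parameters
`(x₁, y₁', z₁')` in `T₁` such that `(I₁; x₁, y₁', z₁')` is very well prepared, with
`β_{x₁,y₁',z₁'}(I₁) < β_{x,y,z}(I)` and `Sing_r(I₁) ⊂ V(x₁, z₁')`."  Its proof (p. 34 l. 42 – p. 36 l. 52)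
applies "the translation `y' = y − ηx` and well prepare by some substitution `z' = z − Ψ(x, y')`. This
does not change `α, β` or `γ`. Set `δ' = δ_{x,y',z'}(I)`" and states (p. 35 l. 63): "We have thus
reduced the proof to showing that `δ' < β`." — the Tr1 step with `η ≠ 0` in `(x, y, z)` is the Tr1
step with `η = 0` in `(x, y', z')`, for which `β₁ = δ'` by the correspondence `σ(a, b) = (a + b − 1, b)` of
Lemma 10.11 (that chart step is `PointBlowupPolygonLaws` / `PointStepPrepared` in the tree and is NOT
repeated here).

THIS FILE PROVES THE REDUCED STATEMENT "`δ' < β`" (the tree's `gammaMinusS < betaS`) in the case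
`(α, β) = (γ − δ, δ)` (the case `(α, β) ≠ (γ − δ, δ)` is the clause `δ' ≤ δ < β` of Definition 10.8 (1),
i.e. `Cutkosky2009.VeryWellPrepared` case 1), following the printed computation (20)–(24):
Lemma 10.1's consequence (20) `α + β > 1` is the hypothesis `δs > L`; "(α, β) is prepared" is used
through the WELL PREPARATION of `(x, y, z)` (Hironaka's minimality of a well prepared polygon,
`PolygonMinimality`: a solvable `v` on the `δ`-line would let a dissolution raise `δ`); `α < 1` ("since
we must have that `Sing_r(I) = V(x, y, z)`", p. 35 l. 59–60) and `β > 0` are hypotheses; Lemma 10.16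
(`Literature.AlgebraicGeometry.Cutkosky2009.Lemma1016`) enters through its own one-line proof, the
Frobenius identity `(x + y)^{pˢr₀} = (x^{pˢ} + y^{pˢ})^{r₀}`; the field `k` (algebraically closed in
print) is only required to be PERFECT — the proof extracts a `pˢ`-th root once (p. 35 l. 55–58:
"`t ≥ s` … `a_{00r}(z + ωx^α y^β)^r = a_{00r} z^r + F_g`, a contradiction").

## Dictionary

As in `VeryWellPreparation.lean`: Cutkosky `(z, x, y)` = tree `c = (y, u₁, u₂)`; `L·γ = deltaS`,
`L·δ = gammaMinusS`, `L·α = alphaS`, `L·β = betaS`; the translation `y' = y − ηx` is `shiftU₂ c φ` (here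
`φ` a UNIT: `η ≠ 0`); a well preparation is `shiftZ · t`, `t ∈ (u₁, u₂)`, ending `WellPrepared`. The
`δ`-line `S(γ)` carries the weight `W = (δs, L, L)` (`levelWeight μ δs 1 1`), and the vertex `(γ, 0)`
of the translated polygon is cut out by the tilted weight `(δs, L, 2L)` = the canonical line through
`w⁻` of `FacePreparation` when `δ = 0`.

## What is PROVED (theorems only; no named fact; bookkeeping definitions `shearSub`, `zSub`,
`vSet`, `sigma0`, `unshear`, and the private `AllGE`)

* §Subst/§Tilt — initial forms transform by the graded substitution under a change of parameters
  that is triangular and homogeneous for the weight (`IsInForm.subst`; instances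
  `inForm_shiftU₂_of_eq` for the translation along a weight with `W₁ = W₂`, `inForm_shiftZ_shiftMon`
  for the dissolution `y ↦ y + λu^v` at the vertex weight), and pass to a weight raised on `X₂` by
  dropping the monomials involving `X₂` (`IsInForm.xfree_tilt`, `inForm_shiftU₂_tilt`);
* §Shape — the monomials of a level-line initial form of `g ∈ J` are Newton points on that line or
  the corner `Y^μ` (`mem_pts_of_mem_support_inForm_levelWeight`), every Newton point minimising the
  line is such a monomial (`exists_mem_support_inForm_of_isMinOn`), the `Y^μ` corner is one for a
  good system (`exists_coeff_inForm_single_ne_zero`), and the `v`-SHAPE of the `δ`-line initial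
  forms when `w⁻ = v` (`support_inForm_subset_vSet`: the set `W` of the printed proof);
* §Algebra — over the residue field: un-shearing `σ₀ : X₂ ↦ −φ̄X₁` is injective on polynomials
  supported over one vertex (`eq_of_bind₁_sigma0_eq`; (21)–(22)), the coefficient
  `binom(r₀, r₀−1) c` of `(X₀^q + cX₁^N)^{r₀}` (`coeff_X_pow_add_C_mul_X_pow_pow`; the use of Lemma
  10.16 — in this formalization Frobenius `(X₀ + ψ̄X₁^γ)^{pˢr₀} = (X₀^{pˢ} + ψ̄^{pˢ}X₁^{γpˢ})^{r₀}`
  replaces the binomial-coefficient bookkeeping (23), exactly as in the printed proof of Lemma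
  10.16), the binomial form `E = (X₀^{pˢ} + Ω U₁^A U₂^B)^{r₀}` of (24) (`support_binomialE_subset_vSet`,
  `bind₁_sigma0_binomialE`, `bind₁_tau_binomialE`, `binomialE_eq_linear_pow`), and the dissolved
  form after the `(γ, 0)`-preparation with its `δ`-line bound and the coefficient
  `r₀ e Ω (−1)^{e−1} φ̄^{pᵗ(e−1)} ≠ 0` of the new vertex (`dissolved_form`; p. 36 l. 1–16);
* §Translate — the point `(γ, 0)` of the translated polygon and `γ⁻ = 0` there
  (`exists_gammaZero_point`, `gammaMinusS_shiftU₂_eq_zero`);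
* §Main — **`gammaMinusS_reach_lt_betaS`**: THE REDUCED THEOREM 10.17 "`δ′ < β`" in the case
  `(α, β) = (γ − δ, δ)`: for `R` regular local of dimension `3` with PERFECT residue field,
  `c = (y, u₁, u₂)` well prepared with a `Y^μ`-corner (good parameters), `J ⊆ 𝔪^μ`, `δs > L`
  (`γ > 1`, eq. (20)), `w⁻ = v`, `αs < L` (`α < 1`), `βs > 0`, `φ` a unit (`η ≠ 0`) and any
  `t ∈ (u₁, u₂)` making `c′ = (y + t, u₁, u₂ + φu₁)` well prepared: `γ⁻s(c′) < βs(c)`.  Its two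
  halves are `gammaMinusS_reach_lt_betaS_of_solvable` (the case "(γ, 0) not prepared", (22)–(24))
  and `gammaMinusS_lt_of_not_dvd` (the dissolution step, p. 35 l. 51 – p. 36 l. 16); the case
  "(γ, 0) prepared" is the persistence of a prepared `w⁻` (`PolygonMinimality`).

Brick G5 of the discharge programme of the named fact `Cutkosky2009_Thm10_18`
(`CutkoskySurfaceOmegaSequence.lean`): with `VeryWellPreparation.lean` (Def. 10.8, Lemmas 10.7, 10.9)
what remains for `Cutkosky2009_Thm10_18_holds` is the chart step `σ(a, b) = (a + b − 1, b)` on very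
well prepared parameters (Lemmas 10.11–10.15) and the assembly of §10.5.
AI-written formalization of the printed computation; weaker than expert review.

## Sources

* S. D. Cutkosky, Amer. J. Math. 131 (2009): Lemma 10.16 p. 34 l. 17–31; Theorem 10.17 and its proof,
  p. 34 l. 35 – p. 36 l. 52 (equations (20)–(24)); Def. 10.8 p. 30–31. [Cutkosky2009]
* V. Cossart, U. Jannsen, S. Saito, LNM 2270 (2020), Def. 8.2, Lemma 8.3 (initial forms), Remark 8.9 (2),
  Def. 11.1, Lemma 11.4. [CossartJannsenSaito2020]
* V. Cossart, O. Piltant, J. Algebra 320 (2008), §4 p. 10–11 (scaled coordinates, solvable vertices).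
  [CossartPiltant2008]
-/

noncomputable section

open IsLocalRing MvPolynomial

namespace Literature.AlgebraicGeometry.Resolution

universe u

variable {R : Type u} [CommRing R]

/-! ## Initial forms under graded triangular substitutions -/

section Subst

/-- A substitution `Xᵢ ↦ σᵢ` with `σᵢ` weighted homogeneous of weight `wᵢ` preserves weighted
homogeneity. [cite: CossartJannsenSaito2020, Lemma 8.3] -/
theorem isWeightedHomogeneous_bind₁ {S : Type u} [CommSemiring S] {w : Fin 3 → ℕ}
    {σ : Fin 3 → MvPolynomial (Fin 3) S} (hσ : ∀ i, (σ i).IsWeightedHomogeneous w (w i))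
    {F : MvPolynomial (Fin 3) S} {n : ℕ} (hF : F.IsWeightedHomogeneous w n) :
    (bind₁ σ F).IsWeightedHomogeneous w n := by
  classical
  rw [F.as_sum, map_sum]
  refine IsWeightedHomogeneous.sum _ _ _ fun m hm => ?_
  have hwt : Finsupp.weight w m = n := hF (mem_support_iff.mp hm)
  rw [bind₁_monomial, ← hwt, Finsupp.weight_apply, Finsupp.sum]
  exact (IsWeightedHomogeneous.prod _ _ _ fun i _ => (hσ i).pow (m i)).C_mul _

/-- **Initial forms under a graded triangular change of parameters.** Let `c, c′` be two parameter
systems and `σ` polynomials with `σᵢ(c′) = cᵢ`, `σᵢ` weighted homogeneous of weight `wᵢ`, and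
`F^{w}_{n+1}(c) ⊆ F^{w}_{n+1}(c′)`. If `P` is the `w`-initial form of `g` in degree `n` for `c`, then
`P(σ̄)` is the `w`-initial form of `g` in degree `n` for `c′` (`σ̄` = reduction of `σ` mod `𝔪`).
[cite: CossartJannsenSaito2020, Def. 8.2 (2), Lemma 8.3] -/
theorem IsInForm.subst [IsLocalRing R] {c c' : Fin 3 → R} {w : Fin 3 → ℕ} {n : ℕ} {g : R}
    {P : MvPolynomial (Fin 3) (ResidueField R)} (h : IsInForm c w n g P)
    (σ : Fin 3 → MvPolynomial (Fin 3) R) (hσw : ∀ i, (σ i).IsWeightedHomogeneous w (w i))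
    (hσc : ∀ i, eval c' (σ i) = c i)
    (hle : weightedIdealW c w (n + 1) ≤ weightedIdealW c' w (n + 1)) :
    IsInForm c' w n g (bind₁ (fun i => MvPolynomial.map (residue R) (σ i)) P) := by
  obtain ⟨F, hF, hFP, hrem⟩ := h
  refine ⟨bind₁ σ F, isWeightedHomogeneous_bind₁ hσw hF, by rw [map_bind₁, hFP], ?_⟩
  have hev : eval c' (bind₁ σ F) = eval c F := by
    rw [show eval c' = eval₂Hom (RingHom.id R) c' from rfl, eval₂Hom_bind₁]
    have : (fun i => eval₂Hom (RingHom.id R) c' (σ i)) = c := by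
      funext i; exact hσc i
    rw [this]; rfl
  rw [hev]; exact hle hrem

/-- The substitution of the shear `u₂ ↦ u₂ + φu₁` read backwards: `y ↦ Y`, `u₁ ↦ U₁`,
`u₂ ↦ U₂ − φU₁` (old parameters in terms of the new ones). [cite: Cutkosky2009, Lemma 10.6 (19), p. 30 l. 31–47] -/
def shearSub (phi : R) : Fin 3 → MvPolynomial (Fin 3) R := ![X 0, X 1, X 2 - C phi * X 1]

/-- The substitution of the dissolution `y ↦ y + λu₁^{v₁}u₂^{v₂}` read backwards: `y ↦ Y − λU^v`.
[cite: Cutkosky2009, Lemma 10.2 (18), p. 29 l. 130–142] -/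
def zSub (lam : R) (v₁ v₂ : ℕ) : Fin 3 → MvPolynomial (Fin 3) R :=
  ![X 0 - C lam * monomial (vexp v₁ v₂) 1, X 1, X 2]

/-- Components of `shearSub`. [cite: Cutkosky2009, Lemma 10.6 (19), p. 30 l. 31–47] -/
theorem shearSub_apply (phi : R) :
    shearSub phi 0 = X 0 ∧ shearSub phi 1 = X 1 ∧ shearSub phi 2 = X 2 - C phi * X 1 :=
  ⟨rfl, rfl, rfl⟩

/-- Components of `zSub`. [cite: Cutkosky2009, Lemma 10.2 (18), p. 29 l. 130–142] -/
theorem zSub_apply (lam : R) (v₁ v₂ : ℕ) :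
    zSub lam v₁ v₂ 0 = X 0 - C lam * monomial (vexp v₁ v₂) 1 ∧ zSub lam v₁ v₂ 1 = X 1 ∧
      zSub lam v₁ v₂ 2 = X 2 :=
  ⟨rfl, rfl, rfl⟩

/-- `shearSub` is homogeneous when `W₁ = W₂` (translations move points along the `δ`-line).
[cite: Cutkosky2009, Lemma 10.6, p. 30 l. 59–63] -/
theorem isWeightedHomogeneous_shearSub {w : Fin 3 → ℕ} (hw : w 1 = w 2) (phi : R) :
    ∀ i, (shearSub phi i).IsWeightedHomogeneous w (w i) := by
  intro i
  fin_cases i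
  · exact isWeightedHomogeneous_X _ _ _
  · exact isWeightedHomogeneous_X _ _ _
  · show (X 2 - C phi * X 1 : MvPolynomial (Fin 3) R).IsWeightedHomogeneous w (w 2)
    have h1 : (X 2 : MvPolynomial (Fin 3) R).IsWeightedHomogeneous w (w 2) :=
      isWeightedHomogeneous_X _ _ _
    have h2 : (C phi * X 1 : MvPolynomial (Fin 3) R).IsWeightedHomogeneous w (w 2) := by
      rw [← hw]; exact (isWeightedHomogeneous_X _ _ _).C_mul _
    exact (weightedHomogeneousSubmodule R w (w 2)).sub_mem h1 h2

/-- `zSub` is homogeneous when the shift monomial has the weight of `y`.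
[cite: Cutkosky2009, Lemma 10.2, p. 29 l. 130–142] -/
theorem isWeightedHomogeneous_zSub {w : Fin 3 → ℕ} {v₁ v₂ : ℕ}
    (hv : Finsupp.weight w (vexp v₁ v₂) = w 0) (lam : R) :
    ∀ i, (zSub lam v₁ v₂ i).IsWeightedHomogeneous w (w i) := by
  intro i
  fin_cases i
  · show (X 0 - C lam * monomial (vexp v₁ v₂) 1 : MvPolynomial (Fin 3) R).IsWeightedHomogeneous w
      (w 0)
    have h1 : (X 0 : MvPolynomial (Fin 3) R).IsWeightedHomogeneous w (w 0) :=
      isWeightedHomogeneous_X _ _ _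
    have h2 : (C lam * monomial (vexp v₁ v₂) 1 : MvPolynomial (Fin 3) R).IsWeightedHomogeneous w
        (w 0) := (isWeightedHomogeneous_monomial _ _ _ hv).C_mul _
    exact (weightedHomogeneousSubmodule R w (w 0)).sub_mem h1 h2
  · exact isWeightedHomogeneous_X _ _ _
  · exact isWeightedHomogeneous_X _ _ _

/-- `shearSub` recovers the old parameters from the sheared ones. [cite: Cutkosky2009, Lemma 10.6 (19), p. 30 l. 31–47] -/
theorem eval_shiftU₂_shearSub (c : Fin 3 → R) (phi : R) :
    ∀ i, eval (shiftU₂ c phi) (shearSub phi i) = c i := by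
  intro i
  fin_cases i
  · simp [shearSub]
  · simp [shearSub]
  · simp [shearSub]

/-- `zSub` recovers the old parameters from the shifted ones. [cite: Cutkosky2009, Lemma 10.2 (18), p. 29 l. 130–142] -/
theorem eval_shiftZ_zSub (c : Fin 3 → R) (lam : R) (v₁ v₂ : ℕ) :
    ∀ i, eval (shiftZ c (shiftMon c lam v₁ v₂)) (zSub lam v₁ v₂ i) = c i := by
  intro i
  fin_cases i
  · show eval (shiftZ c (shiftMon c lam v₁ v₂)) (X 0 - C lam * monomial (vexp v₁ v₂) 1) = c 0
    rw [map_sub, map_mul, eval_X, eval_C, eval_monomial_eq_monom3, monom3_vexp, shiftZ_zero,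
      shiftZ_one, shiftZ_two, shiftMon]
    ring
  · simp [zSub]
  · simp [zSub]

variable [IsRegularLocalRing R] (c : Fin 3 → R)
  (hgen : Ideal.span {c 0, c 1, c 2} = maximalIdeal R) (hdim : ringKrullDim R = 3)

include hgen hdim in
/-- **The initial form along a line with `W₁ = W₂` (the `δ`-line) of the translated system**
`(y, u₁, u₂ + φu₁)` is the old one with `U₂ ↦ U₂ − φ̄U₁` ("substituting `y₁ = y − ηxⁿ` into the
monomial", Lemma 10.6 (19), here `n = 1`). [cite: Cutkosky2009, Lemma 10.6 (19), p. 30 l. 31–63; Thm. 10.17 proof (21), p. 35 l. 97–113] -/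
theorem inForm_shiftU₂_of_eq (phi : R) {w : Fin 3 → ℕ} (hwpos : ∀ i, 0 < w i) (hw : w 1 = w 2)
    {n : ℕ} {g : R} (hg : g ∈ weightedIdealW c w n) :
    inForm (shiftU₂ c phi) w n g =
      bind₁ (fun i => MvPolynomial.map (residue R) (shearSub phi i)) (inForm c w n g) := by
  have hgen' : Ideal.span {shiftU₂ c phi 0, shiftU₂ c phi 1, shiftU₂ c phi 2} = maximalIdeal R := by
    rw [span_triple_shiftU₂]; exact hgen
  have h := (isInForm_inForm c hgen hdim hwpos hg).subst (c' := shiftU₂ c phi) (shearSub phi)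
    (isWeightedHomogeneous_shearSub hw phi) (eval_shiftU₂_shearSub c phi)
    (by rw [weightedIdealW_shiftU₂ c phi w hw.symm.le])
  exact (h.eq_inForm (shiftU₂ c phi) hgen' hdim hwpos).symm

include hgen hdim in
/-- **The initial form of the dissolved system** `(y + λu^v, u)` along a weight for which `u^v` has
the weight of `y` is the old one with `Y ↦ Y − λ̄U^v` ("substituting `z₁ = z − ηx^a y^b` into the
monomial", Lemma 10.2 (18)). [cite: Cutkosky2009, Lemma 10.2 (18), p. 29 l. 130–142; Thm. 10.17 proof, p. 36 l. 5–16] -/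
theorem inForm_shiftZ_shiftMon (lam : R) {v₁ v₂ : ℕ} {w : Fin 3 → ℕ} (hwpos : ∀ i, 0 < w i)
    (hv : Finsupp.weight w (vexp v₁ v₂) = w 0) (hvpos : 0 < v₁ + v₂) {n : ℕ} {g : R}
    (hg : g ∈ weightedIdealW c w n) :
    inForm (shiftZ c (shiftMon c lam v₁ v₂)) w n g =
      bind₁ (fun i => MvPolynomial.map (residue R) (zSub lam v₁ v₂ i)) (inForm c w n g) := by
  have hgen' : Ideal.span {shiftZ c (shiftMon c lam v₁ v₂) 0, shiftZ c (shiftMon c lam v₁ v₂) 1,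
      shiftZ c (shiftMon c lam v₁ v₂) 2} = maximalIdeal R := by
    rw [span_triple_shiftZ c lam hvpos]; exact hgen
  have h := (isInForm_inForm c hgen hdim hwpos hg).subst (c' := shiftZ c (shiftMon c lam v₁ v₂))
    (zSub lam v₁ v₂) (isWeightedHomogeneous_zSub hv lam) (eval_shiftZ_zSub c lam v₁ v₂)
    (by rw [weightedIdealW_shiftZ c lam w (by rw [← weight_vexp, hv])])
  exact (h.eq_inForm _ hgen' hdim hwpos).symm

end Subst

/-! ## Tilting a weight: the `X₂`-free part of an initial form -/

section Tilt

/-- Monotonicity of `F^{w}_ρ` in the weight: a monomial of `w`-weight `≥ ρ` has `w′`-weight `≥ ρ`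
for `w ≤ w′`. (Same statement as the private `PolygonMinimality.weightedIdealW_mono_weight`.) [folklore] -/
private theorem weightedIdealW_mono_weight' (c : Fin 3 → R) {w w' : Fin 3 → ℕ}
    (h : ∀ i, w i ≤ w' i) (ρ : ℕ) : weightedIdealW c w ρ ≤ weightedIdealW c w' ρ := by
  apply Ideal.span_le.mpr
  rintro _ ⟨e, he, rfl⟩
  refine monomial_mem_weightedIdealW c w' (he.trans ?_)
  rw [Finsupp.weight_apply, Finsupp.weight_apply]
  exact Finsupp.sum_le_sum fun i _ => by simpa using Nat.mul_le_mul_left _ (h i)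

/-- Weights on `Fin 3` written out. [folklore] -/
private theorem weight_fin3 (w : Fin 3 → ℕ) (m : Fin 3 →₀ ℕ) :
    Finsupp.weight w m = w 0 * m 0 + w 1 * m 1 + w 2 * m 2 := by
  rw [Finsupp.weight_apply, Finsupp.sum_fintype _ _ (by simp)]
  simp only [Fin.sum_univ_three, smul_eq_mul]
  ring

/-- The `X₂`-free part of a `w`-form of degree `n` is a `w′`-form of degree `n` for any weight `w′`
agreeing with `w` on `X₀, X₁`. [folklore] -/
private theorem isWeightedHomogeneous_xfree_raise {S : Type u} [CommRing S] {w w' : Fin 3 → ℕ}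
    (h0 : w' 0 = w 0) (h1 : w' 1 = w 1) {F : MvPolynomial (Fin 3) S} {n : ℕ}
    (hF : F.IsWeightedHomogeneous w n) : (xfree 2 F).IsWeightedHomogeneous w' n := by
  intro m hm
  rw [coeff_xfree] at hm
  split_ifs at hm with h2
  · have hwt : Finsupp.weight w m = n := hF hm
    rw [← hwt, weight_fin3, weight_fin3, h0, h1, h2, mul_zero, mul_zero]
  · exact absurd rfl hm

/-- **Tilting** (the pattern of `ReAdaptation.IsInForm.tilt_two` for general weights): if `w′`
agrees with `w` on `X₀, X₁` and is larger on `X₂`, the `w′`-initial form of `g` in degree `n` is the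
`X₂`-free part of its `w`-initial form in degree `n` — the monomials involving `X₂` move to higher
`w′`-weight. [cite: CossartJannsenSaito2020, Lemma 11.4; Def. 8.2] -/
theorem IsInForm.xfree_tilt [IsLocalRing R] {c : Fin 3 → R} {w w' : Fin 3 → ℕ} (h0 : w' 0 = w 0)
    (h1 : w' 1 = w 1) (h2 : w 2 < w' 2) {n : ℕ} {g : R}
    {P : MvPolynomial (Fin 3) (ResidueField R)} (h : IsInForm c w n g P) :
    IsInForm c w' n g (xfree 2 P) := by
  classical
  obtain ⟨F, hF, hFP, hrem⟩ := h
  have hle : ∀ i, w i ≤ w' i := by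
    intro i; fin_cases i
    · exact h0.ge
    · exact h1.ge
    · exact h2.le
  refine ⟨xfree 2 F, isWeightedHomogeneous_xfree_raise h0 h1 hF, by rw [← xfree_map, hFP], ?_⟩
  have hsplit : g - eval c (xfree 2 F) = (g - eval c F) + eval c (F - xfree 2 F) := by
    rw [map_sub]; ring
  rw [hsplit]
  refine Ideal.add_mem _ (weightedIdealW_mono_weight' c hle _ hrem) ?_
  refine eval_mem_weightedIdealW_of_forall_le c w' fun m hm => ?_
  rw [mem_support_iff, coeff_sub, coeff_xfree] at hm
  split_ifs at hm with hm2
  · exact absurd (sub_self _) hm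
  · rw [sub_zero] at hm
    have hwt : Finsupp.weight w m = n := hF hm
    have hm2' : 1 ≤ m 2 := Nat.one_le_iff_ne_zero.mpr hm2
    rw [← hwt, weight_fin3, weight_fin3, h0, h1]
    have : w 2 * m 2 + 1 ≤ w' 2 * m 2 := by
      have := Nat.mul_le_mul_right (m 2) (Nat.succ_le_of_lt h2)
      rw [Nat.succ_mul] at this; omega
    omega

/-- The `X₂`-free part as a substitution `X₂ ↦ 0`. [folklore] -/
private theorem xfree_two_eq_bind₁ {S : Type u} [CommRing S] (F : MvPolynomial (Fin 3) S) :
    xfree 2 F = bind₁ ![X 0, X 1, 0] F := by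
  classical
  conv_rhs => rw [F.as_sum]
  rw [map_sum, xfree, Finset.sum_filter]
  refine Finset.sum_congr rfl fun m _ => ?_
  rw [← aeval_eq_bind₁, aeval_monomial, Finsupp.prod_fintype _ _ (by simp), Fin.prod_univ_three,
    algebraMap_eq]
  simp only [Matrix.cons_val_zero, Matrix.cons_val_one, Matrix.cons_val]
  split_ifs with hm
  · rw [hm, pow_zero, mul_one, monomial_eq, Finsupp.prod_fintype _ _ (by simp), Fin.prod_univ_three,
      hm, pow_zero, mul_one]
  · rw [zero_pow hm, mul_zero, mul_zero]

end Tilt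

/-! ## The `δ`-line initial forms: supports, the `v`-shape, the `Y^μ` corner -/

section Shape

/-- Scaled reading of a level-weight equality for an exponent of `y`-degree `< μ` (the half-plane /
weight dictionary). [cite: CossartJannsenSaito2020, Remark 8.9 (2)] -/
theorem lin_spt_eq_of_weight_levelWeight_eq {μ w₀ p₁ p₂ : ℕ} {e : Fin 3 →₀ ℕ} (he : e 0 < μ)
    (h : Finsupp.weight (levelWeight μ w₀ p₁ p₂) e = w₀ * μ) :
    p₁ * spt₁ μ e + p₂ * spt₂ μ e = w₀ := by
  rw [weight_levelWeight, factorial_mul_eq_sub_mul he] at h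
  have hpos : 0 < μ - e 0 := by omega
  have hμ' : w₀ * μ = w₀ * e 0 + w₀ * (μ - e 0) := by rw [← Nat.mul_add]; congr 1; omega
  have h' : (μ - e 0) * (p₁ * spt₁ μ e + p₂ * spt₂ μ e) = (μ - e 0) * w₀ := by
    rw [mul_comm (μ - e 0) w₀]; omega
  exact Nat.eq_of_mul_eq_mul_left hpos h'

/-- An exponent of `y`-degree `≥ μ` on a positive level line in degree `w₀ μ` is the corner
`(μ, 0, 0)` (the half-plane / weight dictionary). [cite: CossartJannsenSaito2020, Remark 8.9 (2)] -/
theorem eq_single_of_weight_levelWeight_eq {μ w₀ p₁ p₂ : ℕ} (hw₀ : 0 < w₀) (hp₁ : 0 < p₁) (hp₂ : 0 < p₂)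
    {e : Fin 3 →₀ ℕ} (he : μ ≤ e 0) (h : Finsupp.weight (levelWeight μ w₀ p₁ p₂) e = w₀ * μ) :
    e = Finsupp.single 0 μ := by
  rw [weight_levelWeight] at h
  have hL := Nat.factorial_pos μ
  have h0 : e 0 = μ := by
    rcases he.eq_or_lt with h' | h'
    · exact h'.symm
    · exfalso
      have : w₀ * μ < w₀ * e 0 := Nat.mul_lt_mul_of_pos_left h' hw₀
      omega
  rw [h0] at h
  have h12 : p₁ * e 1 + p₂ * e 2 = 0 := by
    have : μ.factorial * (p₁ * e 1 + p₂ * e 2) = 0 := by omega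
    rcases Nat.mul_eq_zero.mp this with h' | h'
    · omega
    · exact h'
  have h1 : e 1 = 0 := by
    rcases Nat.eq_zero_or_pos (e 1) with h' | h'
    · exact h'
    · have := Nat.mul_pos hp₁ h'; omega
  have h2 : e 2 = 0 := by
    rcases Nat.eq_zero_or_pos (e 2) with h' | h'
    · exact h'
    · have := Nat.mul_pos hp₂ h'; omega
  ext i
  fin_cases i
  · simpa using h0
  · simpa using h1
  · simpa using h2

/-- `spt₁ e = a` in exponent form: `e₁ L = a (μ − e₀)` (`e₀ < μ`) — the scaled coordinates
`(A₁, A₂)/(μ − |B|)·L` of Cossart–Piltant. [cite: CossartPiltant2008, §4 p. 10] -/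
theorem spt₁_eq_iff {μ a : ℕ} {e : Fin 3 →₀ ℕ} (he : e 0 < μ) :
    spt₁ μ e = a ↔ e 1 * μ.factorial = a * (μ - e 0) := by
  rw [spt₁, ← sub_mul_sfac he]
  have hs := sfac_pos he
  constructor
  · intro h; rw [← h]; ring
  · intro h
    have : (e 1 * sfac μ e) * (μ - e 0) = a * (μ - e 0) := by rw [← h]; ring
    exact Nat.eq_of_mul_eq_mul_right (by omega) this

/-- `spt₂ e = b` in exponent form: `e₂ L = b (μ − e₀)` (`e₀ < μ`) — the scaled coordinates of
Cossart–Piltant. [cite: CossartPiltant2008, §4 p. 10] -/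
theorem spt₂_eq_iff {μ b : ℕ} {e : Fin 3 →₀ ℕ} (he : e 0 < μ) :
    spt₂ μ e = b ↔ e 2 * μ.factorial = b * (μ - e 0) := by
  rw [spt₂, ← sub_mul_sfac he]
  have hs := sfac_pos he
  constructor
  · intro h; rw [← h]; ring
  · intro h
    have : (e 2 * sfac μ e) * (μ - e 0) = b * (μ - e 0) := by rw [← h]; ring
    exact Nat.eq_of_mul_eq_mul_right (by omega) this

/-- The exponents "at the vertex `(a/L, b/L)`" together with the corner `(μ, 0, 0)`: those of
`y`-degree `e₀ < μ` with scaled point `(a, b)`, written without division. For each `y`-degree there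
is at most one of them (`vSet_eq_of_apply_zero_eq`). [cite: Cutkosky2009, Thm. 10.17 proof, the set `W`, p. 34 l. 65–67] -/
def vSet (μ a b : ℕ) : Set (Fin 3 →₀ ℕ) :=
  {m | m = Finsupp.single 0 μ ∨
    (m 0 < μ ∧ m 1 * μ.factorial = a * (μ - m 0) ∧ m 2 * μ.factorial = b * (μ - m 0))}

/-- In `vSet μ a b` the `y`-degree determines the exponent ("for `0 ≤ k < r` … `i = α(r − k)`,
`j = β(r − k)`"). [cite: Cutkosky2009, Thm. 10.17 proof (23), p. 35 l. 36–40] -/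
theorem vSet_eq_of_apply_zero_eq {μ a b : ℕ} {m m' : Fin 3 →₀ ℕ} (hm : m ∈ vSet μ a b)
    (hm' : m' ∈ vSet μ a b) (h : m 0 = m' 0) : m = m' := by
  have hL := Nat.factorial_pos μ
  rcases hm with rfl | ⟨hm0, hm1, hm2⟩ <;> rcases hm' with rfl | ⟨hm0', hm1', hm2'⟩
  · rfl
  · simp at h; omega
  · simp at h; omega
  · ext i
    fin_cases i
    · exact h
    · show m 1 = m' 1
      rw [← h] at hm1'
      exact Nat.eq_of_mul_eq_mul_right hL (hm1.trans hm1'.symm)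
    · show m 2 = m' 2
      rw [← h] at hm2'
      exact Nat.eq_of_mul_eq_mul_right hL (hm2.trans hm2'.symm)

variable [IsRegularLocalRing R] (c : Fin 3 → R)
  (hgen : Ideal.span {c 0, c 1, c 2} = maximalIdeal R) (hdim : ringKrullDim R = 3)
  {J : Ideal R} {μ : ℕ}

include hgen hdim in
/-- `J ⊆ F^{(w₀, Lp₁, Lp₂)}_{w₀ μ}` for the level `w₀ = min (p₁ x₁ + p₂ x₂)` over the polygon — in
particular along the `δ`-line (`p₁ = p₂ = 1`, `w₀ = δs`). [cite: CossartJannsenSaito2020, Remark 8.9 (2)] -/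
theorem le_weightedIdealW_deltaLine (hδ : 0 < deltaS c J μ) :
    J ≤ weightedIdealW c (levelWeight μ (deltaS c J μ) 1 1) (deltaS c J μ * μ) :=
  (le_weightedIdealW_levelWeight_iff c hgen hdim J hδ Nat.one_pos Nat.one_pos).mpr
    fun e he => by simpa using deltaS_le he

include hgen hdim in
/-- **Monomials of a level-line initial form are Newton points on the line, or the corner.** For
`J ⊆ F^{(w₀, Lp₁, Lp₂)}_{w₀ μ}` and `g ∈ J`, every monomial of `in(g)` in degree `w₀ μ` is `Y^μ` or
an exponent of `pts c J μ` with `p₁ x₁ + p₂ x₂ = w₀`. [cite: CossartJannsenSaito2020, Def. 8.2 (2), Def. 8.5 (4)] -/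
theorem mem_pts_of_mem_support_inForm_levelWeight {w₀ p₁ p₂ : ℕ} (hw₀ : 0 < w₀) (hp₁ : 0 < p₁)
    (hp₂ : 0 < p₂) (hJ : J ≤ weightedIdealW c (levelWeight μ w₀ p₁ p₂) (w₀ * μ)) {g : R}
    (hg : g ∈ J) {m : Fin 3 →₀ ℕ}
    (hm : m ∈ (inForm c (levelWeight μ w₀ p₁ p₂) (w₀ * μ) g).support) :
    m = Finsupp.single 0 μ ∨ (m ∈ pts c J μ ∧ p₁ * spt₁ μ m + p₂ * spt₂ μ m = w₀) := by
  have hw := levelWeight_pos (μ := μ) hw₀ hp₁ hp₂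
  have hwt : Finsupp.weight (levelWeight μ w₀ p₁ p₂) m = w₀ * μ :=
    isWeightedHomogeneous_inForm c hgen hdim hw (hJ hg) (mem_support_iff.mp hm)
  by_cases hm0 : m 0 < μ
  · right
    have hinit := (mem_support_inForm_iff c hgen hdim hw (hJ hg) hwt).mp hm
    exact ⟨⟨mem_occ_of_isInitialTerm c hg hw hinit, hm0⟩, lin_spt_eq_of_weight_levelWeight_eq hm0 hwt⟩
  · exact Or.inl (eq_single_of_weight_levelWeight_eq hw₀ hp₁ hp₂ (not_lt.mp hm0) hwt)

include hgen hdim in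
/-- **The `v`-shape of the `δ`-line initial forms when `w⁻ = v`** ("For `g = Σ a_{ijk} xⁱyʲzᵏ ∈ I`
… set `F_g = Σ_{(i,j,k)∈W} a_{ijk} xⁱyʲzᵏ`", `W` = the exponents over the vertex `(α, β)`): if
`(δ − γ⁻, γ⁻) = (α, β)`, every monomial of the `(δs, L, L)`-initial form of `g ∈ J` in degree `δs μ`
is `Y^μ` or lies over `v`, i.e. belongs to `vSet μ αs βs`. [cite: Cutkosky2009, Thm. 10.17 proof, p. 34 l. 63 – p. 35 l. 4] -/
theorem support_inForm_subset_vSet (hδ : 0 < deltaS c J μ)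
    (hwv : deltaS c J μ = alphaS c J μ + gammaMinusS c J μ ∧ gammaMinusS c J μ = betaS c J μ)
    {g : R} (hg : g ∈ J) :
    ((inForm c (levelWeight μ (deltaS c J μ) 1 1) (deltaS c J μ * μ) g).support : Set (Fin 3 →₀ ℕ)) ⊆
      vSet μ (alphaS c J μ) (betaS c J μ) := by
  intro m hm
  rcases mem_pts_of_mem_support_inForm_levelWeight c hgen hdim hδ Nat.one_pos Nat.one_pos
      (le_weightedIdealW_deltaLine c hgen hdim hδ) hg (Finset.mem_coe.mp hm) with h | ⟨hpts, hline⟩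
  · exact Or.inl h
  · right
    rw [one_mul, one_mul] at hline
    have hα := alphaS_le hpts
    have hγ := gammaMinusS_le hpts hline
    have h1 : spt₁ μ m = alphaS c J μ := by omega
    have h2 : spt₂ μ m = betaS c J μ := by omega
    exact ⟨hpts.2, (spt₁_eq_iff hpts.2).mp h1, (spt₂_eq_iff hpts.2).mp h2⟩

include hgen hdim in
/-- **A point of the polygon on a level line is a monomial of some initial form along that line**:
if `e ∈ pts c J μ` minimises `p₁ x₁ + p₂ x₂` (value `w₀ > 0`), some `g ∈ J` has `e` in the support
of its `(w₀, Lp₁, Lp₂)`-initial form in degree `w₀ μ`. [cite: CossartJannsenSaito2020, Lemma 8.3 (4), Def. 8.2 (2)] -/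
theorem exists_mem_support_inForm_of_isMinOn {p₁ p₂ : ℕ} (hp₁ : 0 < p₁) (hp₂ : 0 < p₂)
    {e : Fin 3 →₀ ℕ} (he : e ∈ pts c J μ)
    (hmin : ∀ x ∈ pts c J μ, p₁ * spt₁ μ e + p₂ * spt₂ μ e ≤ p₁ * spt₁ μ x + p₂ * spt₂ μ x)
    (hpos : 0 < p₁ * spt₁ μ e + p₂ * spt₂ μ e) :
    ∃ g ∈ J, e ∈ (inForm c (levelWeight μ (p₁ * spt₁ μ e + p₂ * spt₂ μ e) p₁ p₂)
      ((p₁ * spt₁ μ e + p₂ * spt₂ μ e) * μ) g).support := by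
  obtain ⟨g, hg, hinit⟩ := exists_isInitialTerm_levelWeight_of_isMinOn c hgen hdim hp₁ hp₂ he hmin hpos
  have hw := levelWeight_pos (μ := μ) hpos hp₁ hp₂
  have hJ : J ≤ weightedIdealW c (levelWeight μ (p₁ * spt₁ μ e + p₂ * spt₂ μ e) p₁ p₂)
      ((p₁ * spt₁ μ e + p₂ * spt₂ μ e) * μ) :=
    (le_weightedIdealW_levelWeight_iff c hgen hdim J hpos hp₁ hp₂).mpr hmin
  exact ⟨g, hg, (mem_support_inForm_iff c hgen hdim hw (hJ hg) (weight_levelWeight_self he.2 p₁ p₂)).mpr hinit⟩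

include hgen hdim in
/-- **The `Y^μ` corner of a good system is a monomial of the initial form along every level line**
(from `HasMonic` and `J ⊆ 𝔪^μ`, via fine unit representatives — the argument of the private
`PolygonMinimality.exists_isInitialTerm_single`). [cite: Cutkosky2009, §10.2 p. 28 l. 65–66 ("`b_{00r} ≠ 0`")] -/
theorem exists_coeff_inForm_single_ne_zero (hJμ : J ≤ maximalIdeal R ^ μ) (hmon : HasMonic c J μ)
    {V : Fin 3 → ℕ} (hV : ∀ i, 0 < V i) {n : ℕ} (hJV : J ≤ weightedIdealW c V n)
    (hwt : Finsupp.weight V (Finsupp.single 0 μ) = n) :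
    ∃ g ∈ J, (inForm c V n g).coeff (Finsupp.single 0 μ) ≠ 0 := by
  classical
  obtain ⟨f₀, hf₀, hcoeff⟩ := hmon
  refine ⟨f₀, hf₀, ?_⟩
  have hgenr := span_range_eq_of_span_triple c hgen
  have h1 : ∀ i, 0 < (fun _ : Fin 3 => (1 : ℕ)) i := fun _ => Nat.one_pos
  have hf1 : f₀ ∈ weightedIdealW c (fun _ => 1) μ := by
    rw [weightedIdealW_one_eq_pow c hgenr]; exact hJμ hf₀
  have hwt1 : Finsupp.weight (fun _ : Fin 3 => (1 : ℕ)) (Finsupp.single 0 μ) = μ := by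
    rw [Finsupp.weight_apply, Finsupp.sum_single_index (by simp)]; simp
  have hinit1 : IsInitialTerm c (fun _ => 1) f₀ (Finsupp.single 0 μ) :=
    (mem_support_inForm_iff c hgen hdim h1 hf1 hwt1).mp (mem_support_iff.mpr hcoeff)
  obtain ⟨G, hGu, -, hGrem⟩ := exists_unitRep c hgenr f₀ (n + μ + 2)
  have hrem1 : f₀ - eval c G ∈ weightedIdealW c (fun _ => 1) (n + μ + 2) :=
    pow_maximalIdeal_le_weightedIdealW c hgenr h1 _ hGrem
  have hremV : f₀ - eval c G ∈ weightedIdealW c V (n + μ + 2) :=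
    pow_maximalIdeal_le_weightedIdealW c hgenr hV _ hGrem
  have hsupp : Finsupp.single 0 μ ∈ G.support :=
    ((isInitialTerm_iff_of_unitRep c hgen hdim h1 hGu hrem1 (by rw [hwt1]; omega)).mp hinit1).1
  have hmin : ∀ m ∈ G.support, n ≤ Finsupp.weight V m :=
    (mem_weightedIdealW_iff_of_unitRep c hgen hdim hV hGu hremV (by omega)).mp (hJV hf₀)
  have hinitV : IsInitialTerm c V f₀ (Finsupp.single 0 μ) :=
    (isInitialTerm_iff_of_unitRep c hgen hdim hV hGu hremV (by rw [hwt]; omega)).mpr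
      ⟨hsupp, fun m hm => by rw [hwt]; exact hmin m hm⟩
  exact mem_support_iff.mp ((mem_support_inForm_iff c hgen hdim hV (hJV hf₀) hwt).mpr hinitV)

end Shape

/-! ## Polynomial algebra over the residue field: un-shearing, supports, the binomial identities -/

section Algebra

variable {K : Type u} [Field K]

/-- Monomials written out: `monomial (a, b, d) r = r X₀^a X₁^b X₂^d`. [folklore] -/
private theorem monomial_fin3 (r : K) (a b d : ℕ) :
    (monomial (Finsupp.single 0 a + Finsupp.single 1 b + Finsupp.single 2 d) r :
      MvPolynomial (Fin 3) K) = C r * X 0 ^ a * X 1 ^ b * X 2 ^ d := by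
  rw [monomial_eq, Finsupp.prod_fintype _ _ (by simp), Fin.prod_univ_three]
  simp
  ring

/-- The substitution `X₀ ↦ X₀, X₁ ↦ X₁, X₂ ↦ −φ̄X₁`: the shear `X₂ ↦ X₂ − φ̄X₁` followed by
`X₂ ↦ 0` ("`F_{g,(γ,0)} = Σ a_{ijk} ηʲ x^{i+j} zᵏ`": the terms of `F_g(x, y′ + ηx, z)` contributing to
`(γ, 0)`). [cite: Cutkosky2009, Thm. 10.17 proof, p. 35 l. 14–17] -/
def sigma0 (φb : K) : Fin 3 → MvPolynomial (Fin 3) K := ![X 0, X 1, -(C φb * X 1)]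

/-- `X₂ ↦ 0` after the shear is `sigma0`. [folklore] -/
private theorem bind₁_zero_shearSub (φb : K) :
    (fun i => bind₁ ![X 0, X 1, (0 : MvPolynomial (Fin 3) K)] (shearSub φb i)) = sigma0 φb := by
  funext i
  fin_cases i
  · simp [shearSub, sigma0]
  · simp [shearSub, sigma0]
  · simp [shearSub, sigma0]

/-- The `X₂`-free part of a sheared polynomial is its image under `sigma0`. [cite: Cutkosky2009, Thm. 10.17 proof (21), p. 35 l. 8–17] -/
theorem xfree_bind₁_shearSub (φb : K) (P : MvPolynomial (Fin 3) K) :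
    xfree 2 (bind₁ (shearSub φb) P) = bind₁ (sigma0 φb) P := by
  rw [xfree_two_eq_bind₁, bind₁_bind₁, bind₁_zero_shearSub]

/-- The exponent of `σ₀(X^m)`: `(m₀, m₁ + m₂, 0)`. [folklore] -/
def unshear (m : Fin 3 →₀ ℕ) : Fin 3 →₀ ℕ := Finsupp.single 0 (m 0) + Finsupp.single 1 (m 1 + m 2)

/-- Component. [folklore] -/
@[simp] private theorem unshear_zero (m : Fin 3 →₀ ℕ) : unshear m 0 = m 0 := by simp [unshear]

/-- `σ₀` on monomials. [folklore] -/
private theorem bind₁_sigma0_monomial (φb : K) (m : Fin 3 →₀ ℕ) (a : K) :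
    bind₁ (sigma0 φb) (monomial m a) = monomial (unshear m) (a * (-φb) ^ (m 2)) := by
  rw [← aeval_eq_bind₁, aeval_monomial, Finsupp.prod_fintype _ _ (by simp), Fin.prod_univ_three,
    algebraMap_eq]
  have : unshear m = Finsupp.single 0 (m 0) + Finsupp.single 1 (m 1 + m 2) + Finsupp.single 2 0 := by
    simp [unshear]
  rw [this, monomial_fin3]
  simp only [sigma0, Matrix.cons_val_zero, Matrix.cons_val_one, Matrix.cons_val]
  rw [show (-(C φb * X 1) : MvPolynomial (Fin 3) K) = C (-φb) * X 1 by rw [C_neg]; ring, mul_pow,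
    ← C_pow, C_mul]
  ring

/-- **Coefficients after `σ₀`**: the coefficient of `X^e` in `σ₀(D)` collects the monomials `m` of
`D` with `(m₀, m₁ + m₂) = (e₀, e₁)`, weighted by `(−φ̄)^{m₂}` ((21): "`Σ_λ a_{ijk} η^λ binom(j, λ)
x^{i+λ} (y′)^{j−λ} zᵏ`" at `λ = j`). [cite: Cutkosky2009, Thm. 10.17 proof (21), p. 35 l. 8–17] -/
theorem coeff_bind₁_sigma0 (φb : K) (D : MvPolynomial (Fin 3) K) (e : Fin 3 →₀ ℕ) :
    coeff e (bind₁ (sigma0 φb) D) =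
      ∑ m ∈ D.support with unshear m = e, coeff m D * (-φb) ^ (m 2) := by
  classical
  conv_lhs => rw [D.as_sum, map_sum]
  rw [coeff_sum, Finset.sum_filter]
  refine Finset.sum_congr rfl fun m _ => ?_
  rw [bind₁_sigma0_monomial, coeff_monomial]

/-- A monomial of `σ₀(D)` comes from a monomial of `D`. [folklore] -/
private theorem exists_support_of_mem_support_bind₁_sigma0 (φb : K) (D : MvPolynomial (Fin 3) K)
    {e : Fin 3 →₀ ℕ} (he : e ∈ (bind₁ (sigma0 φb) D).support) :
    ∃ m ∈ D.support, unshear m = e := by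
  classical
  rw [mem_support_iff, coeff_bind₁_sigma0] at he
  obtain ⟨m, hm, -⟩ := Finset.exists_ne_zero_of_sum_ne_zero he
  exact ⟨m, (Finset.mem_filter.mp hm).1, (Finset.mem_filter.mp hm).2⟩

/-- **`σ₀` is injective on polynomials supported over one vertex** (at most one monomial per
`y`-degree, `η ≠ 0`): distinct `k` give distinct monomials `x^{i+j} zᵏ` of `F_{g,(γ,0)}`.
[cite: Cutkosky2009, Thm. 10.17 proof, p. 35 l. 14–20] -/
theorem eq_zero_of_bind₁_sigma0_eq_zero {φb : K} (hφ : φb ≠ 0) {μ a b : ℕ}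
    {D : MvPolynomial (Fin 3) K} (hD : (D.support : Set (Fin 3 →₀ ℕ)) ⊆ vSet μ a b)
    (h : bind₁ (sigma0 φb) D = 0) : D = 0 := by
  classical
  by_contra hne
  obtain ⟨m, hm⟩ := Finset.nonempty_iff_ne_empty.mpr (fun h0 => hne (support_eq_empty.mp h0))
  have hc := congrArg (coeff (unshear m)) h
  rw [coeff_bind₁_sigma0, coeff_zero] at hc
  rw [Finset.sum_eq_single_of_mem m] at hc
  · exact (mul_ne_zero (mem_support_iff.mp hm) (pow_ne_zero _ (neg_ne_zero.mpr hφ))) hc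
  · exact Finset.mem_filter.mpr ⟨hm, rfl⟩
  · intro m' hm' hne'
    exfalso; apply hne'
    obtain ⟨hm's, hum⟩ := Finset.mem_filter.mp hm'
    refine vSet_eq_of_apply_zero_eq (hD (Finset.mem_coe.mpr hm's)) (hD (Finset.mem_coe.mpr hm)) ?_
    have := congrArg (fun f : Fin 3 →₀ ℕ => f 0) hum
    simpa using this

/-- Injectivity of `σ₀` on polynomials supported over one vertex, equational form. [cite: Cutkosky2009, Thm. 10.17 proof, p. 35 l. 14–20] -/
theorem eq_of_bind₁_sigma0_eq {φb : K} (hφ : φb ≠ 0) {μ a b : ℕ} {D D' : MvPolynomial (Fin 3) K}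
    (hD : (D.support : Set (Fin 3 →₀ ℕ)) ⊆ vSet μ a b)
    (hD' : (D'.support : Set (Fin 3 →₀ ℕ)) ⊆ vSet μ a b)
    (h : bind₁ (sigma0 φb) D = bind₁ (sigma0 φb) D') : D = D' := by
  classical
  rw [← sub_eq_zero]
  refine eq_zero_of_bind₁_sigma0_eq_zero hφ (μ := μ) (a := a) (b := b) ?_ (by rw [map_sub, h, sub_self])
  intro m hm
  have := support_sub (σ := Fin 3) D D' (Finset.mem_coe.mp hm)
  rcases Finset.mem_union.mp this with h1 | h1
  · exact hD (Finset.mem_coe.mpr h1)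
  · exact hD' (Finset.mem_coe.mpr h1)

/-- **The coefficient of `X₀^{q(r₀−1)} X₁^N` in `(X₀^q + c X₁^N)^{r₀}` is `r₀ c`** — the term
`k = (r₀ − 1)pˢ` of the proof ("`a_{i,j,(r₀−1)pˢ} ≠ 0`"). [cite: Cutkosky2009, Thm. 10.17 proof, p. 35 l. 48–50] -/
theorem coeff_X_pow_add_C_mul_X_pow_pow (cK : K) {q N r₀ : ℕ} (hq : 0 < q) (hr : 1 ≤ r₀) :
    coeff (Finsupp.single 0 (q * (r₀ - 1)) + Finsupp.single 1 N)
      ((X 0 ^ q + C cK * X 1 ^ N) ^ r₀ : MvPolynomial (Fin 3) K) = r₀ * cK := by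
  classical
  have hterm : ∀ k j : ℕ, ((X 0 ^ q) ^ k * (C cK * X 1 ^ N) ^ j * ((r₀.choose k : ℕ) : MvPolynomial (Fin 3) K))
      = monomial (Finsupp.single 0 (q * k) + Finsupp.single 1 (N * j) + Finsupp.single 2 0)
          (cK ^ j * (r₀.choose k : K)) := by
    intro k j
    rw [monomial_fin3, map_mul, map_pow, map_natCast, ← pow_mul, mul_pow, ← map_pow, ← pow_mul]
    ring
  rw [add_pow, coeff_sum, Finset.sum_eq_single (r₀ - 1)]
  · rw [Nat.sub_sub_self hr, hterm, coeff_monomial, if_pos, pow_one, Nat.choose_symm hr,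
      Nat.choose_one_right]
    · ring
    · ext i
      fin_cases i <;> simp
  · intro k _ hk
    rw [hterm, coeff_monomial, if_neg]
    intro h
    have h0 := congrArg (fun f : Fin 3 →₀ ℕ => f 0) h
    simp at h0
    rcases h0 with h0 | h0 <;> omega
  · intro h
    exact absurd (Finset.mem_range.mpr (by omega)) h

/-! ### Lower bounds on the weights of all monomials -/

/-- Every monomial of `F` has `ω`-weight `≥ a`. [folklore] -/
private def AllGE (ω : Fin 3 → ℕ) (a : ℕ) (F : MvPolynomial (Fin 3) K) : Prop :=
  ∀ n ∈ F.support, a ≤ Finsupp.weight ω n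

/-- `AllGE` for `0`. [folklore] -/
private theorem allGE_zero (ω : Fin 3 → ℕ) (a : ℕ) : AllGE ω a (0 : MvPolynomial (Fin 3) K) := by
  intro n hn; simp at hn

/-- `AllGE` is monotone in the bound. [folklore] -/
private theorem AllGE.mono {ω : Fin 3 → ℕ} {a a' : ℕ} {F : MvPolynomial (Fin 3) K} (h : AllGE ω a F)
    (ha : a' ≤ a) : AllGE ω a' F := fun n hn => ha.trans (h n hn)

/-- `AllGE` for monomials. [folklore] -/
private theorem allGE_monomial (ω : Fin 3 → ℕ) (m : Fin 3 →₀ ℕ) (r : K) :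
    AllGE ω (Finsupp.weight ω m) (monomial m r) := by
  classical
  intro n hn
  have := support_monomial_subset hn
  rw [Finset.mem_singleton] at this
  rw [this]

/-- `AllGE` for powers of variables. [folklore] -/
private theorem allGE_X_pow (ω : Fin 3 → ℕ) (i : Fin 3) (k : ℕ) :
    AllGE ω (ω i * k) (X i ^ k : MvPolynomial (Fin 3) K) := by
  have h := allGE_monomial (K := K) ω (Finsupp.single i k) 1
  rw [X_pow_eq_monomial]
  intro n hn
  have := h n hn
  rwa [Finsupp.weight_apply, Finsupp.sum_single_index (by simp), smul_eq_mul, mul_comm] at this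

/-- `AllGE` for constants. [folklore] -/
private theorem allGE_C (ω : Fin 3 → ℕ) (r : K) : AllGE ω 0 (C r : MvPolynomial (Fin 3) K) :=
  fun _ _ => Nat.zero_le _

/-- `AllGE` under addition. [folklore] -/
private theorem AllGE.add {ω : Fin 3 → ℕ} {a : ℕ} {F G : MvPolynomial (Fin 3) K} (hF : AllGE ω a F)
    (hG : AllGE ω a G) : AllGE ω a (F + G) := by
  classical
  intro n hn
  rcases Finset.mem_union.mp (support_add hn) with h | h
  · exact hF n h
  · exact hG n h

/-- `AllGE` under subtraction. [folklore] -/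
private theorem AllGE.sub {ω : Fin 3 → ℕ} {a : ℕ} {F G : MvPolynomial (Fin 3) K} (hF : AllGE ω a F)
    (hG : AllGE ω a G) : AllGE ω a (F - G) := by
  classical
  intro n hn
  rcases Finset.mem_union.mp (support_sub (σ := Fin 3) F G hn) with h | h
  · exact hF n h
  · exact hG n h

/-- `AllGE` under multiplication (weights add). [folklore] -/
private theorem AllGE.mul {ω : Fin 3 → ℕ} {a b : ℕ} {F G : MvPolynomial (Fin 3) K} (hF : AllGE ω a F)
    (hG : AllGE ω b G) : AllGE ω (a + b) (F * G) := by
  classical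
  intro n hn
  obtain ⟨x, hx, y, hy, rfl⟩ := Finset.mem_add.mp (support_mul F G hn)
  rw [map_add]
  exact Nat.add_le_add (hF x hx) (hG y hy)

/-- `AllGE` under powers. [folklore] -/
private theorem AllGE.pow {ω : Fin 3 → ℕ} {a : ℕ} {F : MvPolynomial (Fin 3) K} (hF : AllGE ω a F) (k : ℕ) :
    AllGE ω (a * k) (F ^ k) := by
  induction k with
  | zero =>
    rw [mul_zero, pow_zero]
    exact allGE_C ω 1
  | succ k ih =>
    rw [pow_succ, Nat.mul_succ]
    exact ih.mul hF

/-- `AllGE` under finite sums. [folklore] -/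
private theorem AllGE.sum {ω : Fin 3 → ℕ} {a : ℕ} {ι : Type*} (s : Finset ι)
    {F : ι → MvPolynomial (Fin 3) K} (hF : ∀ i ∈ s, AllGE ω a (F i)) :
    AllGE ω a (∑ i ∈ s, F i) := by
  classical
  induction s using Finset.induction_on with
  | empty => rw [Finset.sum_empty]; exact allGE_zero ω a
  | insert i s hi ih =>
    rw [Finset.sum_insert hi]
    exact (hF i (Finset.mem_insert_self _ _)).add (ih fun j hj => hF j (Finset.mem_insert_of_mem hj))

/-- A monomial of weight below the bound has coefficient `0`. [folklore] -/
private theorem AllGE.coeff_eq_zero {ω : Fin 3 → ℕ} {a : ℕ} {F : MvPolynomial (Fin 3) K} (hF : AllGE ω a F)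
    {n : Fin 3 →₀ ℕ} (hn : Finsupp.weight ω n < a) : coeff n F = 0 := by
  by_contra h
  exact absurd (hF n (mem_support_iff.mpr h)) (not_le.mpr hn)

/-- **The binomial expansion split after the linear term**: `(Y + W)^e = W^e + e Y W^{e−1} + Y² G`.
[folklore] -/
private theorem exists_add_pow_eq {S : Type u} [CommRing S] (Y W : S) {e : ℕ} (he : 1 ≤ e) :
    ∃ G : S, (Y + W) ^ e = W ^ e + (e : S) * Y * W ^ (e - 1) + Y ^ 2 * G := by
  induction e, he using Nat.le_induction with
  | base => exact ⟨0, by ring⟩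
  | succ e he ih =>
    obtain ⟨G, hG⟩ := ih
    refine ⟨(e : S) * W ^ (e - 1) + G * (Y + W), ?_⟩
    obtain ⟨d, rfl⟩ : ∃ d, e = d + 1 := ⟨e - 1, by omega⟩
    rw [pow_succ, hG]
    simp only [Nat.add_sub_cancel, Nat.cast_add, Nat.cast_one]
    ring

/-- **The dissolved form (24) and its `δ`-line** (p. 36 l. 1–16: after the `(γ, 0)`-preparation
`z = z′ − η^β ω x^γ`, "`G_g = a_{00r}((z′)^{pˢ} + eω^{pˢ}η^{pᵗ(e−1)}(y′)^{pᵗ}x^{αpˢ+pᵗ(e−1)} +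
(y′)^{2pᵗ}Ω(x, y′))^{r₀}`").  For `E₃ = ((X₀ − ψ̄X₁^γ)^q + Ω X₁^A (X₂ − φ̄X₁)^B)^{r₀}` with `q = pˢ`,
`B = e pᵗ`, `A + B = qγ` and `Ω(−1)^e φ̄^B = ψ̄^q`: every monomial `(n₀, n₁, n₂)` of `E₃` satisfies
`pᵗ n₀ + q n₂ ≥ pᵗ q r₀`, and the monomial `(q(r₀−1), A + pᵗ(e−1), pᵗ)` has coefficient
`r₀ e Ω (−1)^{e−1} φ̄^{pᵗ(e−1)}`. [cite: Cutkosky2009, Thm. 10.17 proof (24), p. 35 l. 64 – p. 36 l. 16] -/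
theorem dissolved_form {p : ℕ} [ExpChar K p] (ψb φb Ω : K) {s t e r₀ A γN : ℕ} (he : 1 ≤ e)
    (hr : 1 ≤ r₀) (hAB : A + e * p ^ t = p ^ s * γN) (hΩ : Ω * (-1) ^ e * φb ^ (e * p ^ t) = ψb ^ p ^ s) :
    let E₃ : MvPolynomial (Fin 3) K :=
      ((X 0 - C ψb * X 1 ^ γN) ^ p ^ s + C Ω * X 1 ^ A * (X 2 - C φb * X 1) ^ (e * p ^ t)) ^ r₀
    (∀ n ∈ E₃.support, p ^ t * (p ^ s * r₀) ≤ Finsupp.weight ![p ^ t, 0, p ^ s] n) ∧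
      coeff (Finsupp.single 0 (p ^ s * (r₀ - 1)) + Finsupp.single 1 (A + p ^ t * (e - 1)) +
          Finsupp.single 2 (p ^ t)) E₃ =
        (r₀ : K) * ((e : K) * Ω * (-1) ^ (e - 1) * φb ^ (p ^ t * (e - 1))) := by
  classical
  intro E₃
  -- Frobenius twice and the split binomial expansion
  have h1 : (X 0 - C ψb * X 1 ^ γN : MvPolynomial (Fin 3) K) ^ p ^ s =
      X 0 ^ p ^ s - C (ψb ^ p ^ s) * X 1 ^ (γN * p ^ s) := by
    rw [sub_pow_expChar_pow, mul_pow, ← C_pow, ← pow_mul]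
  set Y : MvPolynomial (Fin 3) K := X 2 ^ p ^ t with hY
  set W : MvPolynomial (Fin 3) K := -(C (φb ^ p ^ t) * X 1 ^ p ^ t) with hW
  have h2 : (X 2 - C φb * X 1 : MvPolynomial (Fin 3) K) ^ (e * p ^ t) = (Y + W) ^ e := by
    rw [mul_comm e, pow_mul, sub_pow_expChar_pow, mul_pow, ← C_pow, hY, hW, sub_eq_add_neg]
  obtain ⟨G, hG⟩ := exists_add_pow_eq Y W he
  -- the cancellation of the `X₁^{qγ}` terms
  have hcancel : C Ω * X 1 ^ A * W ^ e = C (ψb ^ p ^ s) * X 1 ^ (γN * p ^ s) := by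
    have hγ : γN * p ^ s = A + e * p ^ t := by rw [mul_comm]; exact hAB.symm
    rw [hγ, ← hΩ, hW, neg_pow, pow_add]
    simp only [map_mul, map_pow, map_neg, map_one, mul_pow]
    ring
  set M : MvPolynomial (Fin 3) K := C Ω * X 1 ^ A * (C (e : K) * W ^ (e - 1) + Y * G) with hM
  have hinner : (X 0 - C ψb * X 1 ^ γN) ^ p ^ s + C Ω * X 1 ^ A * (X 2 - C φb * X 1) ^ (e * p ^ t) =
      X 0 ^ p ^ s + Y * M := by
    rw [h1, h2, hG]
    have : C Ω * X 1 ^ A * (W ^ e + (e : MvPolynomial (Fin 3) K) * Y * W ^ (e - 1) + Y ^ 2 * G) =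
        C Ω * X 1 ^ A * W ^ e + Y * M := by rw [hM, map_natCast]; ring
    rw [this, hcancel]; ring
  have hE : E₃ = (X 0 ^ p ^ s + Y * M) ^ r₀ := by
    show ((X 0 - C ψb * X 1 ^ γN) ^ p ^ s + C Ω * X 1 ^ A * (X 2 - C φb * X 1) ^ (e * p ^ t)) ^ r₀ = _
    rw [hinner]
  -- weights
  set ω : Fin 3 → ℕ := ![p ^ t, 0, p ^ s] with hω
  have hX0 : AllGE ω (p ^ t * p ^ s) (X 0 ^ p ^ s : MvPolynomial (Fin 3) K) := by
    simpa [hω] using allGE_X_pow (K := K) ω 0 (p ^ s)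
  have hYw : AllGE ω (p ^ s * p ^ t) Y := by
    simpa [hω, hY] using allGE_X_pow (K := K) ω 2 (p ^ t)
  have hM0 : AllGE ω 0 M := fun _ _ => Nat.zero_le _
  have hinnerw : AllGE ω (p ^ t * p ^ s) (X 0 ^ p ^ s + Y * M) := by
    refine hX0.add ?_
    have := hYw.mul hM0
    rw [add_zero, mul_comm] at this
    exact this
  refine ⟨?_, ?_⟩
  · rw [hE]
    have := hinnerw.pow r₀
    rw [mul_assoc] at this
    exact this
  · -- the coefficient: expand `(Y M + X₀^q)^{r₀}` and isolate `j = 1`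
    rw [hE, add_comm (X 0 ^ p ^ s) (Y * M), add_pow, coeff_sum]
    set n : Fin 3 →₀ ℕ := Finsupp.single 0 (p ^ s * (r₀ - 1)) +
      Finsupp.single 1 (A + p ^ t * (e - 1)) + Finsupp.single 2 (p ^ t) with hn
    -- the `X₂`-degree weight
    set ω₂ : Fin 3 → ℕ := ![0, 0, 1] with hω₂
    have hn2 : Finsupp.weight ω₂ n = p ^ t := by
      rw [hn, weight_fin3]; simp [hω₂]
    have hn0 : Finsupp.weight ![1, 0, 0] n = p ^ s * (r₀ - 1) := by
      rw [hn, weight_fin3]; simp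
    have hYw₂ : AllGE ω₂ (p ^ t) Y := by simpa [hω₂, hY] using allGE_X_pow (K := K) ω₂ 2 (p ^ t)
    have hpt : 0 < p ^ t := pow_pos (expChar_pos K p) t
    rw [Finset.sum_eq_single 1]
    · -- `j = 1`
      rw [pow_one, Nat.choose_one_right, hM]
      have hsplit : Y * (C Ω * X 1 ^ A * (C (e : K) * W ^ (e - 1) + Y * G)) * (X 0 ^ p ^ s) ^ (r₀ - 1) *
          (r₀ : MvPolynomial (Fin 3) K) =
        monomial n ((r₀ : K) * ((e : K) * Ω * (-1) ^ (e - 1) * φb ^ (p ^ t * (e - 1)))) +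
          Y * Y * (C Ω * X 1 ^ A * G * (X 0 ^ p ^ s) ^ (r₀ - 1) * C (r₀ : K)) := by
        rw [hn, monomial_fin3, hW, hY, neg_pow]
        simp only [map_mul, map_pow, map_neg, map_one, map_natCast, mul_pow]
        ring
      rw [hsplit, coeff_add, coeff_monomial, if_pos rfl]
      have hrest : AllGE ω₂ (p ^ t + p ^ t + 0)
          (Y * Y * (C Ω * X 1 ^ A * G * (X 0 ^ p ^ s) ^ (r₀ - 1) * C (r₀ : K))) :=
        (hYw₂.mul hYw₂).mul fun _ _ => Nat.zero_le _
      rw [hrest.coeff_eq_zero (by rw [hn2]; omega), add_zero]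
    · -- `j ≠ 1`
      intro j hj hj1
      rcases Nat.lt_or_gt_of_ne hj1 with hj0 | hj2
      · -- `j = 0`: the monomial `X₀^{q r₀}`
        have hj0 : j = 0 := by omega
        subst hj0
        rw [pow_zero, one_mul, Nat.sub_zero, Nat.choose_zero_right, Nat.cast_one, mul_one, ← pow_mul]
        have hw : AllGE ![1, 0, 0] (p ^ s * r₀) (X 0 ^ (p ^ s * r₀) : MvPolynomial (Fin 3) K) := by
          simpa using allGE_X_pow (K := K) ![1, 0, 0] 0 (p ^ s * r₀)
        refine hw.coeff_eq_zero ?_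
        rw [hn0]
        have hps : 0 < p ^ s := pow_pos (expChar_pos K p) s
        exact Nat.mul_lt_mul_of_pos_left (by omega) hps
      · -- `j ≥ 2`: divisible by `X₂^{2pᵗ}`
        have hw : AllGE ω₂ (p ^ t * j + 0 + 0)
            ((Y * M) ^ j * (X 0 ^ p ^ s) ^ (r₀ - j) * ((r₀.choose j : ℕ) : MvPolynomial (Fin 3) K)) := by
          refine (AllGE.mul ?_ fun _ _ => Nat.zero_le _).mul fun _ _ => Nat.zero_le _
          have := (hYw₂.mul (show AllGE ω₂ 0 M from fun _ _ => Nat.zero_le _)).pow j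
          rwa [add_zero] at this
        refine hw.coeff_eq_zero ?_
        rw [hn2]
        have : p ^ t * 2 ≤ p ^ t * j := Nat.mul_le_mul_left _ hj2
        omega
    · intro h; exfalso; simp at h; omega

/-! ### The binomial form `E = (X₀^q + Ω X₁^A X₂^B)^{r₀}` of (24) and its substitutions -/

/-- `vexp` written with all three components. [folklore] -/
private theorem vexp_eq_three (a b : ℕ) :
    vexp a b = Finsupp.single 0 0 + Finsupp.single 1 a + Finsupp.single 2 b := by
  simp [vexp]

/-- The monomial `U₁^a U₂^b` as a polynomial. [folklore] -/
private theorem monomial_vexp (r : K) (a b : ℕ) :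
    (monomial (vexp a b) r : MvPolynomial (Fin 3) K) = C r * X 1 ^ a * X 2 ^ b := by
  rw [vexp_eq_three, monomial_fin3, pow_zero, mul_one]

/-- The terms of the binomial expansion of `E`. [folklore] -/
private theorem binomialE_term (Ω : K) (q r₀ A B k : ℕ) :
    ((X 0 ^ q) ^ k * (C Ω * monomial (vexp A B) 1) ^ (r₀ - k) *
        ((r₀.choose k : ℕ) : MvPolynomial (Fin 3) K)) =
      monomial (Finsupp.single 0 (q * k) + (r₀ - k) • vexp A B) (Ω ^ (r₀ - k) * (r₀.choose k : K)) := by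
  rw [X_pow_eq_monomial, monomial_pow, C_mul_monomial, mul_one, monomial_pow, monomial_mul,
    ← map_natCast (C : K →+* MvPolynomial (Fin 3) K) (r₀.choose k), mul_comm, C_mul_monomial,
    Finsupp.smul_single, smul_eq_mul, mul_comm k q]
  congr 1
  ring

/-- **The support of `E = (X₀^q + Ω U^{(A,B)})^{r₀}` lies over the vertex `(a/L, b/L)`** when
`A L = a q`, `B L = b q`, `μ = q r₀`: its monomials are `Y^μ` and `Y^{qk} U^{(r₀−k)(A,B)}`.
[cite: Cutkosky2009, Thm. 10.17 proof (24), p. 35 l. 64–66] -/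
theorem support_binomialE_subset_vSet (Ω : K) {q r₀ A B μ a b : ℕ} (hq : 0 < q) (hμ : q * r₀ = μ)
    (hA : A * μ.factorial = a * q) (hB : B * μ.factorial = b * q) :
    (((X 0 ^ q + C Ω * monomial (vexp A B) 1) ^ r₀ : MvPolynomial (Fin 3) K).support :
      Set (Fin 3 →₀ ℕ)) ⊆ vSet μ a b := by
  classical
  intro m hm
  rw [Finset.mem_coe, add_pow] at hm
  obtain ⟨k, hk, hmk⟩ := Finset.mem_biUnion.mp (support_sum hm)
  rw [binomialE_term] at hmk
  have hm' := support_monomial_subset hmk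
  rw [Finset.mem_singleton] at hm'
  subst hm'
  have hk' : k ≤ r₀ := by have := Finset.mem_range.mp hk; omega
  rcases hk'.eq_or_lt with rfl | hlt
  · left
    rw [Nat.sub_self, zero_smul, add_zero, hμ]
  · right
    have h0 : ((Finsupp.single 0 (q * k) + (r₀ - k) • vexp A B : Fin 3 →₀ ℕ) : Fin 3 → ℕ) 0 = q * k := by
      simp [vexp]
    have h1 : ((Finsupp.single 0 (q * k) + (r₀ - k) • vexp A B : Fin 3 →₀ ℕ) : Fin 3 → ℕ) 1 =
        (r₀ - k) * A := by
      simp [vexp]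
    have h2 : ((Finsupp.single 0 (q * k) + (r₀ - k) • vexp A B : Fin 3 →₀ ℕ) : Fin 3 → ℕ) 2 =
        (r₀ - k) * B := by
      simp [vexp]
    rw [h0, h1, h2]
    have hsub : μ - q * k = q * (r₀ - k) := by rw [← hμ, Nat.mul_sub]
    refine ⟨?_, ?_, ?_⟩
    · rw [← hμ]; exact Nat.mul_lt_mul_of_pos_left hlt hq
    · rw [hsub, mul_assoc, hA]; ring
    · rw [hsub, mul_assoc, hB]; ring

/-- **`σ₀` of the binomial form**: `σ₀(E) = (X₀^q + Ω(−φ̄)^B X₁^{A+B})^{r₀}`.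
[cite: Cutkosky2009, Thm. 10.17 proof (22)–(23), p. 35 l. 23–40] -/
theorem bind₁_sigma0_binomialE (φb Ω : K) (q r₀ A B : ℕ) :
    bind₁ (sigma0 φb) ((X 0 ^ q + C Ω * monomial (vexp A B) 1) ^ r₀ : MvPolynomial (Fin 3) K) =
      (X 0 ^ q + C (Ω * (-φb) ^ B) * X 1 ^ (A + B)) ^ r₀ := by
  rw [map_pow, map_add, map_pow, map_mul, bind₁_X_right, bind₁_C_right, bind₁_sigma0_monomial, one_mul]
  have hu : unshear (vexp A B) = Finsupp.single 0 0 + Finsupp.single 1 (A + B) + Finsupp.single 2 0 := by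
    simp [unshear, vexp]
  have hv2 : (vexp A B) 2 = B := by simp [vexp]
  rw [hu, hv2, monomial_fin3]
  simp only [sigma0, Matrix.cons_val_zero, pow_zero, mul_one, map_mul]
  ring

/-- The combined substitution of the translation and the `(γ, 0)`-preparation:
`X₀ ↦ X₀ − ψ̄X₁^γ`, `X₁ ↦ X₁`, `X₂ ↦ X₂ − φ̄X₁`. [cite: Cutkosky2009, Thm. 10.17 proof, p. 36 l. 1–3] -/
theorem bind₁_zSub_shearSub (ψb φb : K) (γN : ℕ) :
    (fun i => bind₁ (zSub ψb γN 0) (shearSub φb i)) =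
      ![X 0 - C ψb * X 1 ^ γN, X 1, X 2 - C φb * X 1] := by
  have hm : (monomial (vexp γN 0) 1 : MvPolynomial (Fin 3) K) = X 1 ^ γN := by
    rw [monomial_vexp, map_one, one_mul, pow_zero, mul_one]
  funext i
  fin_cases i
  · simp [shearSub, zSub, hm]
  · simp [shearSub, zSub]
  · simp [shearSub, zSub]

/-- **The binomial form after translation and `(γ, 0)`-preparation** is the `E₃` of
`dissolved_form`. [cite: Cutkosky2009, Thm. 10.17 proof (24), p. 35 l. 64 – p. 36 l. 3] -/
theorem bind₁_tau_binomialE (ψb φb Ω : K) (γN q r₀ A B : ℕ) :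
    bind₁ (fun i => bind₁ (zSub ψb γN 0) (shearSub φb i))
        ((X 0 ^ q + C Ω * monomial (vexp A B) 1) ^ r₀ : MvPolynomial (Fin 3) K) =
      ((X 0 - C ψb * X 1 ^ γN) ^ q + C Ω * X 1 ^ A * (X 2 - C φb * X 1) ^ B) ^ r₀ := by
  rw [bind₁_zSub_shearSub, map_pow, map_add, map_pow, map_mul, bind₁_X_right, bind₁_C_right,
    ← aeval_eq_bind₁, aeval_monomial, Finsupp.prod_fintype _ _ (by simp), Fin.prod_univ_three,
    algebraMap_eq]
  simp only [Matrix.cons_val_zero, Matrix.cons_val_one, Matrix.cons_val, map_one, one_mul]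
  simp [vexp, mul_assoc]

/-- **In characteristic `p`, `(X₀^q + ρ^q U^{q v})^{r₀} = (X₀ + ρ U^v)^{q r₀}`** (`q = pˢ`): when
`pˢ ∣ β pˢ` (i.e. "`t ≥ s`. Then `β ∈ ℕ` … `a_{00r}(z + ωx^α y^β)^r = a_{00r} z^r + F_g`").
[cite: Cutkosky2009, Thm. 10.17 proof, p. 35 l. 51–54] -/
theorem binomialE_eq_linear_pow {p : ℕ} [ExpChar K p] (ρ : K) (s r₀ a' b' : ℕ) :
    ((X 0 ^ p ^ s + C (ρ ^ p ^ s) * monomial (vexp (p ^ s * a') (p ^ s * b')) 1) ^ r₀ :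
        MvPolynomial (Fin 3) K) =
      (X 0 + C ρ * monomial (vexp a' b') 1) ^ (p ^ s * r₀) := by
  rw [pow_mul, add_pow_expChar_pow, mul_pow, ← C_pow, monomial_pow, one_pow]
  congr 3
  simp [vexp, Finsupp.smul_single]

/-- `r₀ = μ / pˢ` (`pˢ ∥ μ`) and `e = B / pᵗ` are non-zero in the residue field: "`p ∤ r₀`",
"`p ∤ e`" (in characteristic `0`: `pˢ = 1`). [cite: Cutkosky2009, Thm. 10.17 proof, p. 35 l. 45–51] -/
theorem natCast_ordCompl_ne_zero (K : Type u) [Field K] (p : ℕ) [ExpChar K p] {n : ℕ} (hn : n ≠ 0) :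
    ((n / p ^ n.factorization p : ℕ) : K) ≠ 0 := by
  have hprod := Nat.ordProj_mul_ordCompl_eq_self n p
  have hne : n / p ^ n.factorization p ≠ 0 := fun h => hn (by rw [← hprod, h, mul_zero])
  cases ‹ExpChar K p› with
  | zero => exact Nat.cast_ne_zero.mpr hne
  | prime hp => exact fun h => Nat.not_dvd_ordCompl hp hn ((CharP.cast_eq_zero_iff K p _).mp h)

end Algebra

/-! ## The translated system `(y, u₁, u₂ + φu₁)`: its tilted initial forms and the point `(γ, 0)` -/

section Translate

variable [IsRegularLocalRing R] (c : Fin 3 → R)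
  (hgen : Ideal.span {c 0, c 1, c 2} = maximalIdeal R) (hdim : ringKrullDim R = 3)
  {J : Ideal R} {μ : ℕ}

omit [IsRegularLocalRing R] in
/-- Reduction of the shear substitution. [folklore] -/
private theorem map_shearSub [IsLocalRing R] (phi : R) :
    (fun i => MvPolynomial.map (residue R) (shearSub phi i)) = shearSub (residue R phi) := by
  funext i
  fin_cases i
  · simp [shearSub]
  · simp [shearSub]
  · simp [shearSub, map_X, map_C]

omit [IsRegularLocalRing R] in
/-- Reduction of the dissolution substitution. [folklore] -/
private theorem map_zSub [IsLocalRing R] (lam : R) (v₁ v₂ : ℕ) :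
    (fun i => MvPolynomial.map (residue R) (zSub lam v₁ v₂ i)) = zSub (residue R lam) v₁ v₂ := by
  funext i
  fin_cases i
  · simp [zSub, map_X, map_C, map_monomial]
  · simp [zSub]
  · simp [zSub]

include hgen hdim in
/-- **The initial form of the translated system along the tilted line `x₁ + 2x₂ = w₀`** is
`σ₀` of the old initial form along `x₁ + x₂ = w₀`: translate (`X₂ ↦ X₂ − φ̄X₁`), then drop the
monomials involving `X₂` ("the terms … contributing to `(γ, 0)` in `|Δ(I; x, y′, z)|` … are
`F_{g,(γ,0)} = Σ_{(i,j,k)∈W} a_{ijk} ηʲ x^{i+j} zᵏ`"). [cite: Cutkosky2009, Thm. 10.17 proof, p. 35 l. 14–17; Lemma 10.6, p. 30] -/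
theorem inForm_shiftU₂_tilt (phi : R) {w₀ : ℕ} (hw₀ : 0 < w₀) {g : R}
    (hg : g ∈ weightedIdealW c (levelWeight μ w₀ 1 1) (w₀ * μ)) :
    inForm (shiftU₂ c phi) (levelWeight μ w₀ 1 2) (w₀ * μ) g =
      bind₁ (sigma0 (residue R phi)) (inForm c (levelWeight μ w₀ 1 1) (w₀ * μ) g) := by
  have hw : ∀ i, 0 < levelWeight μ w₀ 1 1 i := levelWeight_pos hw₀ Nat.one_pos Nat.one_pos
  have hw' : ∀ i, 0 < levelWeight μ w₀ 1 2 i := levelWeight_pos hw₀ Nat.one_pos (by norm_num)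
  have hgen'' : Ideal.span {shiftU₂ c phi 0, shiftU₂ c phi 1, shiftU₂ c phi 2} = maximalIdeal R := by
    rw [span_triple_shiftU₂]; exact hgen
  have h12 : levelWeight μ w₀ 1 1 1 = levelWeight μ w₀ 1 1 2 := by simp
  have hg'' : g ∈ weightedIdealW (shiftU₂ c phi) (levelWeight μ w₀ 1 1) (w₀ * μ) := by
    rwa [weightedIdealW_shiftU₂ c phi _ h12.symm.le]
  have hin := isInForm_inForm (shiftU₂ c phi) hgen'' hdim hw hg''
  have hlt : levelWeight μ w₀ 1 1 2 < levelWeight μ w₀ 1 2 2 := by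
    simp only [levelWeight_two]
    have := Nat.factorial_pos μ
    omega
  have htilt := hin.xfree_tilt (w' := levelWeight μ w₀ 1 2) (by simp) (by simp) hlt
  rw [← htilt.eq_inForm (shiftU₂ c phi) hgen'' hdim hw', inForm_shiftU₂_of_eq c hgen hdim phi hw h12 hg,
    map_shearSub, xfree_bind₁_shearSub]

omit [IsRegularLocalRing R] in
/-- Scaled coordinates of an un-sheared exponent: `σ₀` keeps the `y`-degree, moves the point to the
`x₁`-axis along its line `x₁ + x₂ = const`. [cite: Cutkosky2009, Lemma 10.6 (19), p. 30 l. 31–47] -/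
theorem spt_unshear (μ : ℕ) (e : Fin 3 →₀ ℕ) :
    spt₁ μ (unshear e) = spt₁ μ e + spt₂ μ e ∧ spt₂ μ (unshear e) = 0 := by
  have hs : sfac μ (unshear e) = sfac μ e := by simp [sfac, unshear]
  refine ⟨?_, ?_⟩
  · rw [spt₁, spt₁, spt₂, hs]; simp [unshear]; ring
  · rw [spt₂]; simp [unshear]

omit [IsRegularLocalRing R] in
/-- **The coefficient of `σ₀(D)` at an un-sheared exponent of `D`** when `D` is supported over one
vertex: only that monomial contributes. [cite: Cutkosky2009, Thm. 10.17 proof, p. 35 l. 14–20] -/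
theorem coeff_unshear_bind₁_sigma0 {K : Type u} [Field K] (φb : K) {μ a b : ℕ}
    {D : MvPolynomial (Fin 3) K} (hD : (D.support : Set (Fin 3 →₀ ℕ)) ⊆ vSet μ a b)
    {m : Fin 3 →₀ ℕ} (hm : m ∈ D.support) :
    coeff (unshear m) (bind₁ (sigma0 φb) D) = coeff m D * (-φb) ^ (m 2) := by
  classical
  rw [coeff_bind₁_sigma0]
  rw [Finset.sum_eq_single_of_mem m]
  · exact Finset.mem_filter.mpr ⟨hm, rfl⟩
  intro m' hm' hne'
  exfalso; apply hne'
  obtain ⟨hm's, hum⟩ := Finset.mem_filter.mp hm'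
  refine vSet_eq_of_apply_zero_eq (hD (Finset.mem_coe.mpr hm's)) (hD (Finset.mem_coe.mpr hm)) ?_
  have := congrArg (fun f : Fin 3 →₀ ℕ => f 0) hum
  simpa using this

include hgen hdim in
/-- **The point `(γ, 0)` of the translated polygon** ("If `(I; x, y′, z)` is `(γ, 0)` prepared, then
`δ′ = 0 < β`" presupposes it): when `w⁻ = v` and `η ≠ 0`, the vertex `v` realised in the `δ`-line
initial form of some `g ∈ J` is carried by `σ₀` to a monomial of the tilted initial form of the
translated system with scaled point `(δs, 0)`, which is therefore a point of its polygon.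
[cite: Cutkosky2009, Thm. 10.17 proof, p. 35 l. 14–22] -/
theorem exists_gammaZero_point (hne : (pts c J μ).Nonempty) (hδ : 0 < deltaS c J μ)
    (hwv : deltaS c J μ = alphaS c J μ + gammaMinusS c J μ ∧ gammaMinusS c J μ = betaS c J μ)
    {phi : R} (hphi : IsUnit phi) :
    ∃ g ∈ J, ∃ e ∈ pts c J μ, spt₁ μ e = alphaS c J μ ∧ spt₂ μ e = betaS c J μ ∧
      e ∈ (inForm c (levelWeight μ (deltaS c J μ) 1 1) (deltaS c J μ * μ) g).support ∧
      unshear e ∈ (inForm (shiftU₂ c phi) (levelWeight μ (deltaS c J μ) 1 2) (deltaS c J μ * μ) g).support ∧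
      unshear e ∈ pts (shiftU₂ c phi) J μ ∧ spt₁ μ (unshear e) = deltaS c J μ ∧ spt₂ μ (unshear e) = 0 := by
  obtain ⟨e, he, he1, he2⟩ := exists_pts_v hne
  have hline : spt₁ μ e + spt₂ μ e = deltaS c J μ := by omega
  have hmin : ∀ x ∈ pts c J μ, 1 * spt₁ μ e + 1 * spt₂ μ e ≤ 1 * spt₁ μ x + 1 * spt₂ μ x := by
    intro x hx; simpa [one_mul, hline] using deltaS_le hx
  have hpos : 0 < 1 * spt₁ μ e + 1 * spt₂ μ e := by omega
  obtain ⟨g, hg, hsupp⟩ := exists_mem_support_inForm_of_isMinOn c hgen hdim Nat.one_pos Nat.one_pos he hmin hpos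
  have heq : 1 * spt₁ μ e + 1 * spt₂ μ e = deltaS c J μ := by omega
  rw [heq] at hsupp
  have hJW := le_weightedIdealW_deltaLine c hgen hdim hδ
  have hsub := support_inForm_subset_vSet c hgen hdim hδ hwv hg
  have hφ : residue R phi ≠ 0 := (residue_ne_zero_iff_isUnit phi).mpr hphi
  -- the un-sheared monomial survives in the tilted initial form of the translated system
  have hcoeff : coeff (unshear e) (inForm (shiftU₂ c phi) (levelWeight μ (deltaS c J μ) 1 2)
      (deltaS c J μ * μ) g) ≠ 0 := by
    rw [inForm_shiftU₂_tilt c hgen hdim phi hδ (hJW hg), coeff_unshear_bind₁_sigma0 _ hsub hsupp]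
    exact mul_ne_zero (mem_support_iff.mp hsupp) (pow_ne_zero _ (neg_ne_zero.mpr hφ))
  have hsupp'' := mem_support_iff.mpr hcoeff
  -- hence it is a point of the translated polygon, at `(δs, 0)`
  have hgen'' : Ideal.span {shiftU₂ c phi 0, shiftU₂ c phi 1, shiftU₂ c phi 2} = maximalIdeal R := by
    rw [span_triple_shiftU₂]; exact hgen
  have hJW'' : J ≤ weightedIdealW (shiftU₂ c phi) (levelWeight μ (deltaS c J μ) 1 2) (deltaS c J μ * μ) := by
    refine le_trans ?_ (weightedIdealW_mono_weight' (shiftU₂ c phi)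
      (w := levelWeight μ (deltaS c J μ) 1 1) (fun i => ?_) _)
    · rw [weightedIdealW_shiftU₂ c phi _ (by simp)]; exact hJW
    · fin_cases i
      · simp
      · simp
      · simp; omega
  obtain ⟨hs1, hs2⟩ := spt_unshear μ e
  rcases mem_pts_of_mem_support_inForm_levelWeight (shiftU₂ c phi) hgen'' hdim hδ Nat.one_pos
      (by norm_num) hJW'' hg hsupp'' with h0 | ⟨hpts, -⟩
  · exfalso
    have := congrArg (fun f : Fin 3 →₀ ℕ => f 0) h0
    simp at this
    have := he.2; omega
  · exact ⟨g, hg, e, he, he1, he2, hsupp, hsupp'', hpts, by rw [hs1, hline], hs2⟩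

include hgen hdim in
/-- **`γ⁻` of the translated system is `0`** when `w⁻ = v` and `η ≠ 0`: the point `(γ, 0)` lies on
its `δ`-line (`δ` is unchanged by the translation, `PolygonShear.deltaS_shiftU₂`).
[cite: Cutkosky2009, Thm. 10.17 proof, p. 35 l. 14–22; Lemma 10.7, p. 30 l. 59–63] -/
theorem gammaMinusS_shiftU₂_eq_zero (hJμ : J ≤ maximalIdeal R ^ μ) (hne : (pts c J μ).Nonempty)
    (hδ : 0 < deltaS c J μ)
    (hwv : deltaS c J μ = alphaS c J μ + gammaMinusS c J μ ∧ gammaMinusS c J μ = betaS c J μ)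
    {phi : R} (hphi : IsUnit phi) : gammaMinusS (shiftU₂ c phi) J μ = 0 := by
  obtain ⟨g, -, e, -, -, -, -, -, hpts, hs1, hs2⟩ := exists_gammaZero_point c hgen hdim hne hδ hwv hphi
  have hδ'' := deltaS_shiftU₂ c hgen hdim phi hJμ hne
  have := gammaMinusS_le hpts (by rw [hs1, hs2, hδ'', add_zero])
  rw [hs2] at this
  exact Nat.le_zero.mp this

end Translate

/-! ## Theorem 10.17, the case `(α, β) = (γ − δ, δ)`: `δ′ < β` -/

section Main

variable [IsRegularLocalRing R] (c : Fin 3 → R)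
  (hgen : Ideal.span {c 0, c 1, c 2} = maximalIdeal R) (hdim : ringKrullDim R = 3)
  {J : Ideal R} {μ : ℕ}

include hgen hdim in
/-- **The dissolution step of Theorem 10.17** (p. 35 l. 51 – p. 36 l. 16).  Data: the `δ`-line initial
forms of all `g ∈ J` are `ā_g (Y^{pˢ} + Ω U₁^A U₂^B)^{r₀}` (eq. (24): `A = αpˢ`, `B = βpˢ`,
`A + B = γpˢ`, `μ = pˢr₀`), with `Ω(−φ̄)^B = ψ̄^{pˢ}` (so that the vertex `(γ, 0)` of the translated
system is solvable by `ψ̄`), some `ā_{g*} ≠ 0`, and `pˢ ∤ B`.  Then "`βpˢ = epᵗ` where `p ∤ e`",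
`t < s`; `e = 1` would give "`β = p^{t−s} < 1` and `α < 1` … `γ = α + β = 1`, a contradiction to
(20)"; so `e > 1`, and after the `(γ, 0)`-preparation `y ↦ y + ψu₁^γ` "the term of lowest second
coordinate on `S(γ)`" is `((αpˢ + pᵗ(e−1))/pˢ, pᵗ/pˢ)`, "not in `ℕ²` since `t < s`", hence prepared,
and it persists under the final well preparation: `δ′ = pᵗ/pˢ < epᵗ/pˢ = β`.
[cite: Cutkosky2009, Thm. 10.17 proof, p. 35 l. 51 – p. 36 l. 16] -/
theorem gammaMinusS_lt_of_not_dvd (hJμ : J ≤ maximalIdeal R ^ μ) (hmon : HasMonic c J μ)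
    (hne : (pts c J μ).Nonempty) (hδ : μ.factorial < deltaS c J μ)
    (hwv : deltaS c J μ = alphaS c J μ + gammaMinusS c J μ ∧ gammaMinusS c J μ = betaS c J μ)
    (hα : alphaS c J μ < μ.factorial) (hβ : 0 < betaS c J μ) {phi : R} (hphi : IsUnit phi)
    {γN : ℕ} (hγN : deltaS c J μ = μ.factorial * γN) {p : ℕ} [ExpChar (ResidueField R) p]
    {s r₀ : ℕ} (hqr : p ^ s * r₀ = μ) (hr₀K : ((r₀ : ℕ) : ResidueField R) ≠ 0) {A B : ℕ}
    (hAB : A + B = γN * p ^ s)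
    (hB : B * μ.factorial = betaS c J μ * p ^ s) (hqB : ¬ p ^ s ∣ B) {ψb Ω : ResidueField R}
    (hΩσ : Ω * (-residue R phi) ^ B = ψb ^ p ^ s) (hΩ0 : Ω ≠ 0)
    (hE : ∀ g ∈ J, ∃ a : ResidueField R,
      inForm c (levelWeight μ (deltaS c J μ) 1 1) (deltaS c J μ * μ) g =
        C a * (X 0 ^ p ^ s + C Ω * monomial (vexp A B) 1) ^ r₀)
    {gs : R} (hgs : gs ∈ J) {a : ResidueField R}
    (ha : inForm c (levelWeight μ (deltaS c J μ) 1 1) (deltaS c J μ * μ) gs =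
      C a * (X 0 ^ p ^ s + C Ω * monomial (vexp A B) 1) ^ r₀) (ha0 : a ≠ 0)
    {t : R} (ht : t ∈ Ideal.span ({c 1, c 2} : Set R))
    (hwp' : Cutkosky2009.WellPrepared (shiftZ (shiftU₂ c phi) t) J μ) :
    gammaMinusS (shiftZ (shiftU₂ c phi) t) J μ < betaS c J μ := by
  classical
  -- ### bookkeeping
  have hL := Nat.factorial_pos μ
  have hμpos : 0 < μ := by obtain ⟨e, he⟩ := hne; have := he.2; omega
  have hδpos : 0 < deltaS c J μ := by omega
  have hγN2 : 2 ≤ γN := by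
    by_contra h
    have : μ.factorial * γN ≤ μ.factorial * 1 := Nat.mul_le_mul_left _ (by omega)
    omega
  have hW : ∀ i, 0 < levelWeight μ (deltaS c J μ) 1 1 i := levelWeight_pos hδpos Nat.one_pos Nat.one_pos
  have hJW : J ≤ weightedIdealW c (levelWeight μ (deltaS c J μ) 1 1) (deltaS c J μ * μ) :=
    le_weightedIdealW_deltaLine c hgen hdim hδpos
  have hgen'' : Ideal.span {shiftU₂ c phi 0, shiftU₂ c phi 1, shiftU₂ c phi 2} = maximalIdeal R := by
    rw [span_triple_shiftU₂]; exact hgen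
  have hJW'' : J ≤ weightedIdealW (shiftU₂ c phi) (levelWeight μ (deltaS c J μ) 1 1) (deltaS c J μ * μ) := by
    rw [weightedIdealW_shiftU₂ c phi _ (by simp)]; exact hJW
  have hφ : residue R phi ≠ 0 := (residue_ne_zero_iff_isUnit phi).mpr hphi
  have hqpos : 0 < p ^ s := pow_pos (expChar_pos (ResidueField R) p) s
  have hr₀pos : 1 ≤ r₀ := by
    rcases Nat.eq_zero_or_pos r₀ with h | h
    · rw [h, mul_zero] at hqr; omega
    · exact h
  have hB0 : B ≠ 0 := by
    intro h0; rw [h0, zero_mul] at hB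
    have := Nat.mul_pos hβ hqpos; omega
  -- ### `p` is prime and `B = e pᵗ`, `t < s`, `e ≥ 2`
  rcases expChar_is_prime_or_one (ResidueField R) p with hprime | hp1
  swap
  · exfalso; apply hqB; rw [hp1, one_pow]; exact one_dvd _
  let t' : ℕ := B.factorization p
  let e : ℕ := B / p ^ t'
  have hBe : p ^ t' * e = B := Nat.ordProj_mul_ordCompl_eq_self B p
  have hBe' : B = e * p ^ t' := by rw [mul_comm]; exact hBe.symm
  have heK : ((e : ℕ) : ResidueField R) ≠ 0 := natCast_ordCompl_ne_zero _ p hB0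
  have hepos : 1 ≤ e := by
    rcases Nat.eq_zero_or_pos e with h | h
    · rw [h, mul_zero] at hBe; exact absurd hBe.symm hB0
    · exact h
  have hts : t' < s := by
    by_contra h
    exact hqB ((pow_dvd_pow p (not_lt.mp h)).trans (Nat.ordProj_dvd B p))
  have hptpos : 0 < p ^ t' := pow_pos hprime.pos _
  have he2 : 2 ≤ e := by
    by_contra h
    have he1 : e = 1 := by omega
    have hlt : B < p ^ s := by
      rw [hBe', he1, one_mul]; exact Nat.pow_lt_pow_right hprime.one_lt hts
    have h1 : betaS c J μ * p ^ s < μ.factorial * p ^ s := by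
      rw [← hB, mul_comm μ.factorial]; exact Nat.mul_lt_mul_of_pos_right hlt hL
    have hβlt : betaS c J μ < μ.factorial := Nat.lt_of_mul_lt_mul_right h1
    have : μ.factorial * 2 ≤ μ.factorial * γN := Nat.mul_le_mul_left _ hγN2
    omega
  have hΩ' : Ω * (-1) ^ e * (residue R phi) ^ (e * p ^ t') = ψb ^ p ^ s := by
    have h1 : ((-1 : ResidueField R)) ^ (e * p ^ t') = (-1) ^ e := by
      rw [mul_comm, pow_mul, neg_one_pow_expChar_pow]
    rw [← hΩσ, hBe', neg_pow (residue R phi) (e * p ^ t'), h1]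
    ring
  have hAB' : A + e * p ^ t' = p ^ s * γN := by rw [← hBe', hAB, mul_comm]
  -- ### the `(γ, 0)`-preparation `y ↦ y + ψ u₁^γ` of the translated system
  obtain ⟨ψ, hψlift⟩ := residue_surjective ψb
  set sm : R := shiftMon (shiftU₂ c phi) ψ γN 0 with hsm_def
  have hsm : sm ∈ Ideal.span ({c 1, c 2} : Set R) := by
    rw [hsm_def, shiftMon, shiftU₂_one, pow_zero, mul_one]
    exact Ideal.mul_mem_left _ _ (Ideal.pow_mem_of_mem _ (Ideal.subset_span (by simp)) _ (by omega))
  set c₃ : Fin 3 → R := shiftZ (shiftU₂ c phi) sm with hc₃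
  have hgen₃ : Ideal.span {c₃ 0, c₃ 1, c₃ 2} = maximalIdeal R := span_triple_reach c hgen phi hsm
  have hmon₃ : HasMonic c₃ J μ := hasMonic_reach c hgen hdim hJμ hmon phi hsm
  have hvw : Finsupp.weight (levelWeight μ (deltaS c J μ) 1 1) (vexp γN 0) =
      levelWeight μ (deltaS c J μ) 1 1 0 := by
    rw [weight_vexp, levelWeight_zero, levelWeight_one, levelWeight_two, hγN]; ring
  have hW₃eq : weightedIdealW c₃ (levelWeight μ (deltaS c J μ) 1 1) (deltaS c J μ * μ) =
      weightedIdealW (shiftU₂ c phi) (levelWeight μ (deltaS c J μ) 1 1) (deltaS c J μ * μ) :=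
    weightedIdealW_shiftZ (shiftU₂ c phi) ψ _
      (le_of_eq (by rw [levelWeight_zero, levelWeight_one, levelWeight_two, hγN]; ring)) _
  have hJW₃ : J ≤ weightedIdealW c₃ (levelWeight μ (deltaS c J μ) 1 1) (deltaS c J μ * μ) := by
    rw [hW₃eq]; exact hJW''
  -- its `δ`-line initial forms: `ā_g E₃`, `E₃` the dissolved form of (24)
  have hP₃ : ∀ g ∈ J, ∀ a : ResidueField R,
      inForm c (levelWeight μ (deltaS c J μ) 1 1) (deltaS c J μ * μ) g =
        C a * (X 0 ^ p ^ s + C Ω * monomial (vexp A B) 1) ^ r₀ →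
      inForm c₃ (levelWeight μ (deltaS c J μ) 1 1) (deltaS c J μ * μ) g =
        C a * ((X 0 - C ψb * X 1 ^ γN) ^ p ^ s +
          C Ω * X 1 ^ A * (X 2 - C (residue R phi) * X 1) ^ (e * p ^ t')) ^ r₀ := by
    intro g hg a ha
    rw [hc₃, hsm_def, inForm_shiftZ_shiftMon (shiftU₂ c phi) hgen'' hdim ψ hW hvw (by omega) (hJW'' hg),
      map_zSub, hψlift, inForm_shiftU₂_of_eq c hgen hdim phi hW (by simp) (hJW hg), map_shearSub,
      bind₁_bind₁, ha, map_mul, bind₁_C_right, bind₁_tau_binomialE, hBe']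
  obtain ⟨hAll, hcoef⟩ := dissolved_form (K := ResidueField R) ψb (residue R phi) Ω
    (r₀ := r₀) hepos hr₀pos hAB' hΩ'
  -- ### the new vertex `((αpˢ + pᵗ(e−1))/pˢ, pᵗ/pˢ)` of the `δ`-line of `c₃`
  set nst : Fin 3 →₀ ℕ := Finsupp.single 0 (p ^ s * (r₀ - 1)) +
    Finsupp.single 1 (A + p ^ t' * (e - 1)) + Finsupp.single 2 (p ^ t') with hnst
  have hnstar : nst ∈ (inForm c₃ (levelWeight μ (deltaS c J μ) 1 1) (deltaS c J μ * μ) gs).support := by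
    rw [mem_support_iff, hP₃ gs hgs a ha, coeff_C_mul, hnst, hcoef]
    refine mul_ne_zero ha0 (mul_ne_zero hr₀K ?_)
    exact mul_ne_zero (mul_ne_zero (mul_ne_zero heK hΩ0) (pow_ne_zero _ (neg_ne_zero.mpr one_ne_zero)))
      (pow_ne_zero _ hφ)
  have hn2 : nst 2 = p ^ t' := by simp [hnst]
  have hn0 : nst 0 = p ^ s * (r₀ - 1) := by simp [hnst]
  obtain ⟨hn_pts, hn_line⟩ : nst ∈ pts c₃ J μ ∧ 1 * spt₁ μ nst + 1 * spt₂ μ nst = deltaS c J μ := by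
    rcases mem_pts_of_mem_support_inForm_levelWeight c₃ hgen₃ hdim hδpos Nat.one_pos Nat.one_pos hJW₃
        hgs hnstar with h0 | h
    · exfalso
      have h02 : nst 2 = (Finsupp.single 0 μ : Fin 3 →₀ ℕ) 2 := by rw [h0]
      rw [hn2, Finsupp.single_apply, if_neg (by decide)] at h02
      exact absurd h02 hptpos.ne'
    · exact h
  rw [one_mul, one_mul] at hn_line
  -- `L / pˢ`
  obtain ⟨Lq, hLq⟩ : p ^ s ∣ μ.factorial := (Dvd.intro _ hqr).trans (Nat.dvd_factorial hμpos le_rfl)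
  have hLqpos : 0 < Lq := by
    rcases Nat.eq_zero_or_pos Lq with h | h
    · rw [h, mul_zero] at hLq; omega
    · exact h
  have hμn : μ - nst 0 = p ^ s := by
    rw [hn0, ← hqr, Nat.mul_sub, mul_one, Nat.sub_sub_self (Nat.le_mul_of_pos_right _ hr₀pos)]
  have hsfacn : sfac μ nst = Lq := by
    rw [sfac, hμn, hLq, Nat.mul_div_cancel_left _ hqpos]
  have hspt2n : spt₂ μ nst = p ^ t' * Lq := by rw [spt₂, hsfacn, hn2]
  have hne₃ : (pts c₃ J μ).Nonempty := ⟨_, hn_pts⟩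
  have hδ₃ : deltaS c₃ J μ = deltaS c J μ := by
    apply le_antisymm
    · have := deltaS_le hn_pts; omega
    · obtain ⟨e₀, he₀, h₀⟩ := exists_pts_deltaS hne₃
      have := (le_weightedIdealW_levelWeight_iff c₃ hgen₃ hdim J hδpos Nat.one_pos Nat.one_pos).mp hJW₃ e₀ he₀
      omega
  -- ### `γ⁻(c₃) = pᵗ L/pˢ`: every `δ`-line point of `c₃` is a monomial of some `ā_g E₃`
  have hγ₃ : gammaMinusS c₃ J μ = Lq * p ^ t' := by
    apply le_antisymm
    · have := gammaMinusS_le hn_pts (by rw [hδ₃]; exact hn_line)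
      rw [hspt2n, mul_comm] at this; exact this
    · obtain ⟨ew, hew, hew1, hew2⟩ := exists_pts_wMinus hne₃
      have hmin₃ : ∀ x ∈ pts c₃ J μ, 1 * spt₁ μ ew + 1 * spt₂ μ ew ≤ 1 * spt₁ μ x + 1 * spt₂ μ x := by
        intro x hx; have := deltaS_le hx; omega
      have hpos₃ : 0 < 1 * spt₁ μ ew + 1 * spt₂ μ ew := by omega
      obtain ⟨gw, hgw, hsw⟩ :=
        exists_mem_support_inForm_of_isMinOn c₃ hgen₃ hdim Nat.one_pos Nat.one_pos hew hmin₃ hpos₃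
      have heqw : 1 * spt₁ μ ew + 1 * spt₂ μ ew = deltaS c J μ := by omega
      rw [heqw] at hsw
      obtain ⟨aw, haw⟩ := hE gw hgw
      rw [hP₃ gw hgw aw haw, C_mul'] at hsw
      have hwt := hAll ew (support_smul hsw)
      rw [weight_fin3] at hwt
      simp only [Matrix.cons_val_zero, Matrix.cons_val_one, Matrix.cons_val, zero_mul, add_zero] at hwt
      rw [hqr] at hwt
      rw [← hew2]
      have hew0 : ew 0 < μ := hew.2
      have hsf : sfac μ ew * (μ - ew 0) = μ.factorial := by rw [mul_comm]; exact sub_mul_sfac hew0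
      have h1 : p ^ t' * (μ - ew 0) ≤ p ^ s * ew 2 := by rw [Nat.mul_sub]; omega
      have key : Lq * p ^ t' * (μ - ew 0) ≤ spt₂ μ ew * (μ - ew 0) := by
        calc Lq * p ^ t' * (μ - ew 0) = Lq * (p ^ t' * (μ - ew 0)) := by ring
          _ ≤ Lq * (p ^ s * ew 2) := Nat.mul_le_mul_left _ h1
          _ = ew 2 * (p ^ s * Lq) := by ring
          _ = ew 2 * (sfac μ ew * (μ - ew 0)) := by rw [hsf, hLq]
          _ = spt₂ μ ew * (μ - ew 0) := by rw [spt₂]; ring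
      exact Nat.le_of_mul_le_mul_right key (by omega)
  -- ### `β = e pᵗ L/pˢ > γ⁻(c₃)`, and `γ⁻(c₃)` is not a lattice value: `c₃` is vacuously `w⁻`-prepared
  have hβeq : betaS c J μ = Lq * B := by
    have h1 : betaS c J μ * p ^ s = Lq * B * p ^ s := by
      rw [← hB, hLq]; ring
    exact Nat.eq_of_mul_eq_mul_right hqpos h1
  have hWMP₃ : WMinusPrepared c₃ J μ := by
    intro v₁ v₂ lam' _ h2 _
    rw [hγ₃, hLq] at h2
    have h3 : Lq * p ^ t' = Lq * (p ^ s * v₂) := by rw [h2]; ring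
    have h4 : p ^ s ∣ p ^ t' := ⟨v₂, Nat.eq_of_mul_eq_mul_left hLqpos h3⟩
    have := (Nat.pow_dvd_pow_iff_le_right hprime.one_lt).mp h4
    omega
  -- ### persistence under the final well preparation (minimality of the well prepared polygon)
  have hfwd : shiftZ c₃ (t - sm) = shiftZ (shiftU₂ c phi) t := by
    rw [hc₃, shiftZ_shiftZ, add_sub_cancel]
  have hback : shiftZ (shiftZ (shiftU₂ c phi) t) (-(t - sm)) = c₃ := by
    rw [hc₃, shiftZ_shiftZ]; congr 1; ring
  have hgen' := span_triple_reach c hgen phi ht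
  have hmon' := hasMonic_reach c hgen hdim hJμ hmon phi ht
  have ht₃ : t - sm ∈ Ideal.span ({c₃ 1, c₃ 2} : Set R) := by
    rw [hc₃, span_pair_shiftZ, span_pair_shiftU₂]; exact Ideal.sub_mem _ ht hsm
  have ht' : -(t - sm) ∈ Ideal.span ({shiftZ (shiftU₂ c phi) t 1, shiftZ (shiftU₂ c phi) t 2} : Set R) := by
    rw [span_pair_shiftZ, span_pair_shiftU₂]; exact Submodule.neg_mem _ (Ideal.sub_mem _ ht hsm)
  have hsub₃ : ∀ (w₀ q₁ q₂ : ℕ), 0 < w₀ → 0 < q₁ → 0 < q₂ →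
      (∀ e ∈ pts c₃ J μ, w₀ ≤ q₁ * spt₁ μ e + q₂ * spt₂ μ e) →
      ∀ e ∈ pts (shiftZ c₃ (t - sm)) J μ, w₀ ≤ q₁ * spt₁ μ e + q₂ * spt₂ μ e := by
    intro w₀ q₁ q₂ _ hq₁ hq₂ hS
    rw [hfwd]
    refine forall_pts_of_forall_pts_shiftZ_of_forall_preparedUpTo _ hgen' hdim hJμ hmon' hwp' ht' hq₁ hq₂ ?_
    rw [hback]; exact hS
  obtain ⟨-, hγ'⟩ := deltaS_gammaMinusS_shiftZ_eq_of_wMinusPrepared c₃ hgen₃ hdim hJμ hmon₃ hne₃ hWMP₃ ht₃ hsub₃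
  rw [hfwd] at hγ'
  rw [hγ', hγ₃, hβeq, hBe']
  exact Nat.mul_lt_mul_of_pos_left (lt_mul_of_one_lt_left hptpos (by omega)) hLqpos

include hgen hdim in
/-- **Case "(γ, 0) not prepared" of Theorem 10.17** (p. 35 l. 17 – p. 36 l. 16).  Setting: `c`
well prepared with a `Y^μ`-corner, `J ⊆ 𝔪^μ`, `γ > 1` (`δs > L`), `(α, β) = (γ − δ, δ)` (`w⁻ = v`),
`α < 1`, `β > 0`, residue field perfect; `η = −φ̄ ≠ 0`; and the vertex `(γ, 0)` of the translated
system `c″ = (y, u₁, u₂ + φu₁)` SOLVABLE along the tilted line `x₁ + 2x₂ = γ` by `ψ̄` (eq. (22)).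
Then `γ ∈ ℕ`; by (23) and Lemma 10.16 the `δ`-line initial forms of all `g ∈ J` are
`ā_g (Y^{pˢ} + Ω U₁^{αpˢ} U₂^{βpˢ})^{r₀}` (24); if `pˢ ∣ βpˢ` the vertex `v` would be solvable along
the `δ`-line, which the well preparation of `c` forbids (Hironaka's minimality); otherwise
`βpˢ = e pᵗ`, `t < s`, `e ≥ 2`, and after the `(γ, 0)`-preparation `y ↦ y + ψu₁^γ` the lowest point
of the `δ`-line is the non-lattice point `((αpˢ + pᵗ(e−1))/pˢ, pᵗ/pˢ)`, which persists under the
final well preparation: `δ′ = pᵗ/pˢ < β`. Conclusion in the tree's letters: for every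
`t ∈ (u₁, u₂)` with `(y + t, u₁, u₂ + φu₁)` well prepared, `γ⁻s < βs`.
[cite: Cutkosky2009, Thm. 10.17 proof, p. 35 l. 17 – p. 36 l. 16; Lemma 10.16 p. 34] -/
theorem gammaMinusS_reach_lt_betaS_of_solvable [PerfectField (ResidueField R)]
    (hJμ : J ≤ maximalIdeal R ^ μ) (hmon : HasMonic c J μ) (hne : (pts c J μ).Nonempty)
    (hwp : Cutkosky2009.WellPrepared c J μ) (hδ : μ.factorial < deltaS c J μ)
    (hwv : deltaS c J μ = alphaS c J μ + gammaMinusS c J μ ∧ gammaMinusS c J μ = betaS c J μ)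
    (hα : alphaS c J μ < μ.factorial) (hβ : 0 < betaS c J μ) {phi : R} (hphi : IsUnit phi)
    {γN : ℕ} (hγN : deltaS c J μ = μ.factorial * γN) {ψb : ResidueField R}
    (hsolv : IsSolvableAt (shiftU₂ c phi) J (levelWeight μ (deltaS c J μ) 1 2) (deltaS c J μ * μ) μ
      (vexp γN 0) ψb)
    {t : R} (ht : t ∈ Ideal.span ({c 1, c 2} : Set R))
    (hwp' : Cutkosky2009.WellPrepared (shiftZ (shiftU₂ c phi) t) J μ) :
    gammaMinusS (shiftZ (shiftU₂ c phi) t) J μ < betaS c J μ := by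
  classical
  -- ### bookkeeping
  have hL := Nat.factorial_pos μ
  have hμpos : 0 < μ := by obtain ⟨e, he⟩ := hne; have := he.2; omega
  have hδpos : 0 < deltaS c J μ := by omega
  have hγN2 : 2 ≤ γN := by
    by_contra h
    have : μ.factorial * γN ≤ μ.factorial * 1 := Nat.mul_le_mul_left _ (by omega)
    omega
  have hW : ∀ i, 0 < levelWeight μ (deltaS c J μ) 1 1 i := levelWeight_pos hδpos Nat.one_pos Nat.one_pos
  have hJW : J ≤ weightedIdealW c (levelWeight μ (deltaS c J μ) 1 1) (deltaS c J μ * μ) :=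
    le_weightedIdealW_deltaLine c hgen hdim hδpos
  have hgen'' : Ideal.span {shiftU₂ c phi 0, shiftU₂ c phi 1, shiftU₂ c phi 2} = maximalIdeal R := by
    rw [span_triple_shiftU₂]; exact hgen
  have hWeq : weightedIdealW (shiftU₂ c phi) (levelWeight μ (deltaS c J μ) 1 1) (deltaS c J μ * μ) =
      weightedIdealW c (levelWeight μ (deltaS c J μ) 1 1) (deltaS c J μ * μ) :=
    weightedIdealW_shiftU₂ c phi _ (by simp) _
  have hJW'' : J ≤ weightedIdealW (shiftU₂ c phi) (levelWeight μ (deltaS c J μ) 1 1) (deltaS c J μ * μ) := by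
    rw [hWeq]; exact hJW
  have hJW' : J ≤ weightedIdealW (shiftU₂ c phi) (levelWeight μ (deltaS c J μ) 1 2) (deltaS c J μ * μ) := by
    refine hJW''.trans (weightedIdealW_mono_weight' _ (fun i => ?_) _)
    fin_cases i
    · simp
    · simp
    · simp; omega
  have hφ : residue R phi ≠ 0 := (residue_ne_zero_iff_isUnit phi).mpr hphi
  -- ### the exponent characteristic, `μ = pˢ r₀`
  let p : ℕ := ringExpChar (ResidueField R)
  haveI hpI : ExpChar (ResidueField R) p := ringExpChar.expChar _
  let s : ℕ := μ.factorization p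
  let r₀ : ℕ := μ / p ^ s
  have hqr : p ^ s * r₀ = μ := Nat.ordProj_mul_ordCompl_eq_self μ p
  have hqpos : 0 < p ^ s := pow_pos (expChar_pos (ResidueField R) p) s
  have hr₀pos : 1 ≤ r₀ := by
    rcases Nat.eq_zero_or_pos r₀ with h | h
    · rw [h, mul_zero] at hqr; omega
    · exact h
  have hr₀K : ((r₀ : ℕ) : ResidueField R) ≠ 0 := natCast_ordCompl_ne_zero _ p hμpos.ne'
  -- ### the tilted initial forms of the translated system are `σ₀` of the `δ`-line forms, and solvable
  have hQ : ∀ g ∈ J, inForm (shiftU₂ c phi) (levelWeight μ (deltaS c J μ) 1 2) (deltaS c J μ * μ) g =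
      bind₁ (sigma0 (residue R phi)) (inForm c (levelWeight μ (deltaS c J μ) 1 1) (deltaS c J μ * μ) g) :=
    fun g hg => inForm_shiftU₂_tilt c hgen hdim phi hδpos (hJW hg)
  have hvs : ∀ g ∈ J, ((inForm c (levelWeight μ (deltaS c J μ) 1 1) (deltaS c J μ * μ) g).support :
      Set (Fin 3 →₀ ℕ)) ⊆ vSet μ (alphaS c J μ) (betaS c J μ) :=
    fun g hg => support_inForm_subset_vSet c hgen hdim hδpos hwv hg
  have hsol : ∀ g ∈ J, ∃ a : ResidueField R,
      bind₁ (sigma0 (residue R phi)) (inForm c (levelWeight μ (deltaS c J μ) 1 1) (deltaS c J μ * μ) g) =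
        C a * (X 0 + C ψb * X 1 ^ γN) ^ μ := by
    intro g hg
    obtain ⟨a, ha⟩ := hsolv.2.2 g hg (hJW' hg)
    refine ⟨a, ?_⟩
    rw [← hQ g hg, ha, monomial_vexp, map_one, one_mul, pow_zero, mul_one]
  have hfrob : (X 0 + C ψb * X 1 ^ γN : MvPolynomial (Fin 3) (ResidueField R)) ^ μ =
      (X 0 ^ p ^ s + C (ψb ^ p ^ s) * X 1 ^ (γN * p ^ s)) ^ r₀ := by
    rw [← hqr, pow_mul, add_pow_expChar_pow, mul_pow, ← C_pow, ← pow_mul]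
  -- ### `ψ̄ ≠ 0`: the vertex `v` survives in the tilted form of some `g_v`
  obtain ⟨gv, hgv, ev, hev, hev1, hev2, -, hevs'', -, -, -⟩ :=
    exists_gammaZero_point c hgen hdim hne hδpos hwv hphi
  have hψ : ψb ≠ 0 := by
    intro h0
    obtain ⟨a, ha⟩ := hsol gv hgv
    rw [h0, map_zero, zero_mul, add_zero, ← hQ gv hgv, X_pow_eq_monomial, C_mul_monomial] at ha
    rw [ha] at hevs''
    have h1 := support_monomial_subset hevs''
    rw [Finset.mem_singleton] at h1
    have h0' := congrArg (fun f : Fin 3 →₀ ℕ => f 0) h1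
    simp at h0'
    have := hev.2; omega
  -- ### the monic element `g*` and its scalar `a* ≠ 0`
  obtain ⟨gs, hgs, hcorner⟩ := exists_coeff_inForm_single_ne_zero c hgen hdim hJμ hmon hW hJW
    (by rw [weight_fin3]; simp)
  obtain ⟨as, has⟩ := hsol gs hgs
  have has0 : as ≠ 0 := by
    intro h0
    rw [h0, map_zero, zero_mul] at has
    have := eq_zero_of_bind₁_sigma0_eq_zero hφ (hvs gs hgs) has
    rw [this, coeff_zero] at hcorner; exact hcorner rfl
  -- ### `i = αpˢ, j = βpˢ ∈ ℕ` from the monomial `Y^{(r₀−1)pˢ} U₁^{γpˢ}` of the solvable shape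
  have hn1 : Finsupp.single 0 (p ^ s * (r₀ - 1)) + Finsupp.single 1 (γN * p ^ s) ∈
      (bind₁ (sigma0 (residue R phi))
        (inForm c (levelWeight μ (deltaS c J μ) 1 1) (deltaS c J μ * μ) gs)).support := by
    rw [has, hfrob, mem_support_iff, coeff_C_mul, coeff_X_pow_add_C_mul_X_pow_pow _ hqpos hr₀pos]
    exact mul_ne_zero has0 (mul_ne_zero hr₀K (pow_ne_zero _ hψ))
  obtain ⟨ms, hms, hums⟩ := exists_support_of_mem_support_bind₁_sigma0 _ _ hn1
  have hms0 : ms 0 = p ^ s * (r₀ - 1) := by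
    have := congrArg (fun f : Fin 3 →₀ ℕ => f 0) hums; simpa [unshear] using this
  have hms12 : ms 1 + ms 2 = γN * p ^ s := by
    have := congrArg (fun f : Fin 3 →₀ ℕ => f 1) hums; simpa [unshear] using this
  have hμq : μ - ms 0 = p ^ s := by
    rw [hms0, ← hqr, Nat.mul_sub, mul_one, Nat.sub_sub_self (Nat.le_mul_of_pos_right _ hr₀pos)]
  have hms0lt : ms 0 < μ := by rw [hms0, ← hqr]; exact Nat.mul_lt_mul_of_pos_left (by omega) hqpos
  obtain ⟨-, hA, hB⟩ : ms 0 < μ ∧ ms 1 * μ.factorial = alphaS c J μ * (μ - ms 0) ∧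
      ms 2 * μ.factorial = betaS c J μ * (μ - ms 0) := by
    rcases hvs gs hgs (Finset.mem_coe.mpr hms) with hsingle | h
    · exfalso
      have := congrArg (fun f : Fin 3 →₀ ℕ => f 0) hsingle
      simp at this; omega
    · exact h
  rw [hμq] at hA hB
  have hB0 : ms 2 ≠ 0 := by
    intro h0; rw [h0, zero_mul] at hB
    have := Nat.mul_pos hβ hqpos; omega
  -- ### the binomial form `E = (Y^{pˢ} + Ω U₁^A U₂^B)^{r₀}` of all `δ`-line initial forms, eq. (24)
  have hnegφ : ((-residue R phi) ^ ms 2 : ResidueField R) ≠ 0 := pow_ne_zero _ (neg_ne_zero.mpr hφ)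
  obtain ⟨Ω, hΩσ⟩ : ∃ Ω : ResidueField R, Ω * (-residue R phi) ^ ms 2 = ψb ^ p ^ s :=
    ⟨ψb ^ p ^ s / (-residue R phi) ^ ms 2, div_mul_cancel₀ _ hnegφ⟩
  have hΩ0 : Ω ≠ 0 := by
    intro h0; rw [h0, zero_mul] at hΩσ; exact pow_ne_zero _ hψ hΩσ.symm
  have hE : ∀ g ∈ J, ∃ a : ResidueField R, inForm c (levelWeight μ (deltaS c J μ) 1 1) (deltaS c J μ * μ) g =
      C a * (X 0 ^ p ^ s + C Ω * monomial (vexp (ms 1) (ms 2)) 1) ^ r₀ := by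
    intro g hg
    obtain ⟨a, ha⟩ := hsol g hg
    refine ⟨a, eq_of_bind₁_sigma0_eq hφ (hvs g hg) ?_ ?_⟩
    · intro m hm
      rw [Finset.mem_coe, C_mul'] at hm
      exact support_binomialE_subset_vSet Ω hqpos hqr hA hB (Finset.mem_coe.mpr (support_smul hm))
    · rw [ha, map_mul, bind₁_C_right, bind₁_sigma0_binomialE, hΩσ, hms12, hfrob]
  -- ### sub-case `pˢ ∣ βpˢ`: `v` is solvable along the `δ`-line — impossible for a well prepared `c`
  by_cases hqB : p ^ s ∣ ms 2
  · exfalso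
    obtain ⟨β', hβ'⟩ := hqB
    have hβ'le : β' ≤ γN := by
      have : p ^ s * β' ≤ γN * p ^ s := by rw [← hβ', ← hms12]; omega
      rw [mul_comm] at this
      exact Nat.le_of_mul_le_mul_right this hqpos
    have hA' : ms 1 = p ^ s * (γN - β') := by
      rw [Nat.mul_sub, ← hβ']
      have : ms 1 + ms 2 = p ^ s * γN := by rw [hms12, mul_comm]
      omega
    have hαL : alphaS c J μ = μ.factorial * (γN - β') := by
      have h1 : p ^ s * ((γN - β') * μ.factorial) = p ^ s * alphaS c J μ := by
        rw [← mul_assoc, ← hA', hA, mul_comm]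
      have := Nat.eq_of_mul_eq_mul_left hqpos h1
      rw [← this, mul_comm]
    have hβL : betaS c J μ = μ.factorial * β' := by
      have h1 : p ^ s * (β' * μ.factorial) = p ^ s * betaS c J μ := by
        rw [← mul_assoc, ← hβ', hB, mul_comm]
      have := Nat.eq_of_mul_eq_mul_left hqpos h1
      rw [← this, mul_comm]
    have hβ'pos : 0 < β' := by
      rcases Nat.eq_zero_or_pos β' with h | h
      · rw [h, mul_zero] at hβL; omega
      · exact h
    -- a `pˢ`-th root of `Ω` (perfect residue field)
    obtain ⟨ρ, hρ⟩ : ∃ ρ : ResidueField R, ρ ^ p ^ s = Ω :=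
      ⟨(iterateFrobeniusEquiv (ResidueField R) p s).symm Ω, by
        rw [← iterateFrobeniusEquiv_def, RingEquiv.apply_symm_apply]⟩
    have hElin : (X 0 ^ p ^ s + C Ω * monomial (vexp (ms 1) (ms 2)) 1 : MvPolynomial (Fin 3) (ResidueField R)) ^ r₀ =
        (X 0 + C ρ * monomial (vexp (γN - β') β') 1) ^ μ := by
      rw [← hρ, hA', hβ', binomialE_eq_linear_pow, hqr]
    obtain ⟨lam, hlam⟩ := residue_surjective ρ
    have hsolv' : IsSolvableAt c J (levelWeight μ (deltaS c J μ) 1 1) (deltaS c J μ * μ) μ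
        (vexp (γN - β') β') (residue R lam) := by
      refine ⟨by simp [vexp], ?_, fun f hf _ => ?_⟩
      · rw [weight_vexp, levelWeight_zero, levelWeight_one, levelWeight_two, hγN, mul_one, ← Nat.add_mul,
          Nat.sub_add_cancel hβ'le, mul_comm]
      · obtain ⟨a, ha⟩ := hE f hf
        exact ⟨a, by rw [ha, hElin, hlam]⟩
    have hv : 0 < (γN - β') + β' := by omega
    have hline : deltaS c J μ = μ.factorial * (1 * (γN - β') + 1 * β') := by
      rw [one_mul, one_mul, Nat.sub_add_cancel hβ'le]; exact hγN
    have hS : ∀ e ∈ pts c J μ, deltaS c J μ ≤ 1 * spt₁ μ e + 1 * spt₂ μ e := by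
      intro e he; simpa [one_mul] using deltaS_le he
    have hev1' : spt₁ μ ev = μ.factorial * (γN - β') := by rw [hev1, hαL]
    have hev2' : spt₂ μ ev = μ.factorial * β' := by rw [hev2, hβL]
    have hlt := lt_of_mem_pts_shiftZ_of_isSolvableAt c hgen hdim lam hv hev hev1' hev2' hδpos Nat.one_pos
      Nat.one_pos hline hS hsolv'
    have hsm : shiftMon c lam (γN - β') β' ∈ Ideal.span ({c 1, c 2} : Set R) := by
      rw [shiftMon]
      refine Ideal.mul_mem_left _ _ (Ideal.mul_mem_left _ _ ?_)
      exact Ideal.pow_mem_of_mem _ (Ideal.subset_span (by simp)) _ hβ'pos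
    have hmin := forall_pts_of_forall_pts_shiftZ_of_forall_preparedUpTo c hgen hdim hJμ hmon hwp hsm
      Nat.one_pos Nat.one_pos (w₀ := deltaS c J μ + 1) (fun e he => by have := hlt e he; omega)
    have := hmin ev hev
    rw [one_mul, one_mul, hev1, hev2] at this
    omega
  -- ### sub-case `pˢ ∤ βpˢ`: positive characteristic — the dissolution lemma
  · obtain ⟨a, ha⟩ := hE gs hgs
    have ha0 : a ≠ 0 := by
      intro h0
      rw [h0, map_zero, zero_mul] at ha
      rw [ha, coeff_zero] at hcorner; exact hcorner rfl
    exact gammaMinusS_lt_of_not_dvd c hgen hdim hJμ hmon hne hδ hwv hα hβ hphi hγN hqr hr₀K hms12 hB hqB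
      hΩσ hΩ0 hE hgs ha ha0 ht hwp'

include hgen hdim in
/-- **Cutkosky 2009, Theorem 10.17 — its heart "`δ′ < β`" in the case `(α, β) = (γ − δ, δ)`, as a
polygon theorem.**  "Apply the translation `y′ = y − ηx` and well prepare by some substitution
`z′ = z − Ψ(x, y′)`. This does not change `α, β` or `γ`. Set `δ′ = δ_{x,y′,z′}(I)`. … We have thus
reduced the proof to showing that `δ′ < β`. … Suppose that `(α, β) = (γ − δ, δ)`." (p. 34 l. 47–63).
Tree form: `R` regular local of dimension `3` with PERFECT residue field (printed: `k` algebraically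
closed; only `pˢ`-th roots are taken), `c = (y, u₁, u₂)` a regular system of parameters, `J ⊆ 𝔪^μ`
with a `Y^μ`-corner (good parameters), `c` well prepared (this and `VeryWellPrepared` case 2 is what
"very well prepared" contributes here), `δs > L` (eq. (20) `α + β > 1`, i.e. `γ > 1`, from Lemma 10.1
and `τ = 1` — `CutkoskyApproximateManifold.factorial_lt_deltaS_of_preparedCorners`), `w⁻ = v`
(`(α, β) = (γ − δ, δ)`), `αs < L` ("`α < 1` since … `Sing_r(I) = V(x, y, z)`"), `βs > 0`, and `φ` a
UNIT (`η ≠ 0`).  Conclusion: for every `t ∈ (u₁, u₂)` such that `c′ = (y + t, u₁, u₂ + φu₁)` is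
well prepared, `γ⁻s(c′) < βs(c)` — i.e. `δ′ < β`.  PROOF as printed: if `(γ, 0)` is prepared on the
translated polygon then `δ′ = 0` (`gammaMinusS_shiftU₂_eq_zero` and persistence of the prepared
vertex `w⁻` under well preparation, `PolygonMinimality`); otherwise (22)–(24)
(`gammaMinusS_reach_lt_betaS_of_solvable`). [cite: Cutkosky2009, Thm. 10.17 p. 34 l. 37 – p. 36 l. 16] -/
theorem gammaMinusS_reach_lt_betaS [PerfectField (ResidueField R)]
    (hJμ : J ≤ maximalIdeal R ^ μ) (hmon : HasMonic c J μ) (hne : (pts c J μ).Nonempty)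
    (hwp : Cutkosky2009.WellPrepared c J μ) (hδ : μ.factorial < deltaS c J μ)
    (hwv : deltaS c J μ = alphaS c J μ + gammaMinusS c J μ ∧ gammaMinusS c J μ = betaS c J μ)
    (hα : alphaS c J μ < μ.factorial) (hβ : 0 < betaS c J μ) {phi : R} (hphi : IsUnit phi)
    {t : R} (ht : t ∈ Ideal.span ({c 1, c 2} : Set R))
    (hwp' : Cutkosky2009.WellPrepared (shiftZ (shiftU₂ c phi) t) J μ) :
    gammaMinusS (shiftZ (shiftU₂ c phi) t) J μ < betaS c J μ := by
  have hL := Nat.factorial_pos μ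
  have hδpos : 0 < deltaS c J μ := by omega
  have hgen'' : Ideal.span {shiftU₂ c phi 0, shiftU₂ c phi 1, shiftU₂ c phi 2} = maximalIdeal R := by
    rw [span_triple_shiftU₂]; exact hgen
  have hne'' := pts_shiftU₂_nonempty c hgen hdim phi hJμ hne
  have hδ'' := deltaS_shiftU₂ c hgen hdim phi hJμ hne
  have hmon'' : HasMonic (shiftU₂ c phi) J μ := by
    have := hasMonic_reach c hgen hdim hJμ hmon phi (t := 0) (Ideal.zero_mem _)
    rwa [shiftZ_zero_eq] at this
  have hγ0 := gammaMinusS_shiftU₂_eq_zero c hgen hdim hJμ hne hδpos hwv hphi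
  have ht'' : t ∈ Ideal.span ({shiftU₂ c phi 1, shiftU₂ c phi 2} : Set R) := by
    rw [span_pair_shiftU₂]; exact ht
  by_cases hA : WMinusPrepared (shiftU₂ c phi) J μ
  · -- "(γ, 0) is prepared": `δ′ = 0 < β`
    have hsub : ∀ (w₀ q₁ q₂ : ℕ), 0 < w₀ → 0 < q₁ → 0 < q₂ →
        (∀ e ∈ pts (shiftU₂ c phi) J μ, w₀ ≤ q₁ * spt₁ μ e + q₂ * spt₂ μ e) →
        ∀ e ∈ pts (shiftZ (shiftU₂ c phi) t) J μ, w₀ ≤ q₁ * spt₁ μ e + q₂ * spt₂ μ e :=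
      fun w₀ q₁ q₂ _ hq₁ hq₂ hS =>
        Cutkosky2009.forall_pts_reach_of_wellPrepared c hgen hdim hJμ hmon phi ht hwp' hq₁ hq₂ hS
    obtain ⟨-, hγ⟩ := deltaS_gammaMinusS_shiftZ_eq_of_wMinusPrepared (shiftU₂ c phi) hgen'' hdim hJμ hmon''
      hne'' hA ht'' hsub
    rw [hγ, hγ0]; exact hβ
  · -- "(γ, 0) is not prepared": solvable by some `ψ̄` along the tilted line `x₁ + 2x₂ = γ`
    unfold WMinusPrepared at hA
    push Not at hA
    obtain ⟨v₁, v₂, lam, h1, h2, hsolv⟩ := hA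
    have hwt : wMinusWeight (shiftU₂ c phi) J μ = levelWeight μ (deltaS c J μ) 1 2 := by
      simp only [wMinusWeight, wMinusLevel, tiltN, hγ0, hδ'', zero_add, one_mul, add_zero]
    have hlev : wMinusLevel (shiftU₂ c phi) J μ * μ = deltaS c J μ * μ := by
      simp only [wMinusLevel, tiltN, hγ0, hδ'', zero_add, one_mul, add_zero]
    rw [hwt, hlev] at hsolv
    rw [hγ0] at h1 h2
    have hv₂ : v₂ = 0 := by
      rcases Nat.eq_zero_or_pos v₂ with h | h
      · exact h
      · have := Nat.mul_pos hL h; omega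
    subst hv₂
    have hγN : deltaS c J μ = μ.factorial * v₁ := by rw [← hδ'']; omega
    exact gammaMinusS_reach_lt_betaS_of_solvable c hgen hdim hJμ hmon hne hwp hδ hwv hα hβ hphi hγN hsolv ht hwp'

end Main

end Literature.AlgebraicGeometry.Resolution

end
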